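import Literature.NumberTheory.Automorphic.BLZPeriodCocycle

/-!
# Towards BLZ Proposition 5.1 (injectivity of `r : E_s^Γ → H¹(Γ; V_s^ω)`) — proofs

Bruggeman, Lewis and Zagier, *Period functions for Maass wave forms and cohomology*,
Mem. AMS 237 no. 1118 (2015) [BruggemanLewisZagier2015], Proposition 5.1 (p. 30; proof p. 31;
page numbers = PDF pages of the held authors' version `paper:doi-10-1090-memo-1118`):
"If the discrete subgroup `Γ ⊂ G` is infinite, then `r`, `p` and `q` are injective."
The statement is vendored as the named fact `BruggemanLewisZagier2015_prop_5_1` in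
`Literature/NumberTheory/Automorphic/BLZPeriodCocycle.lean`; this sibling file collects the
proved steps of the printed argument (kept separate from the definitions file, which other
BLZ facts also extend).

## The printed proof (p. 31) and its ingredients

The map `r` is the connecting homomorphism of the long exact sequence of
`0 → V_s^ω → H_s → V_s^{-ω} → 0` ((2.12): analytic vectors, germs of holomorphic functions on
a deleted neighbourhood of `P¹(ℝ)`, hyperfunctions), composed with the inverse Poisson
transform `E_s^Γ ≅ (V_s^{-ω})^Γ` (Theorems 2.1–2.2); hence `ker r` is the image of `H_s^Γ`, and
`H_s^Γ = {0}` for infinite discrete `Γ` by an argument-principle computation on a collar of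
`S¹` in the disc model, using `s ∉ ℤ`. The first term of that sequence is `(V_s^ω)^Γ` ((5.3)),
which vanishes because analytic vectors decay like `|t|^{-2 Re s}` at `∞` ((2.2)).

## What is here (all proved)

* `IsAnalyticVector.exists_norm_le`: `φ ∈ V_s^ω ⇒ ‖φ(t)‖ ≤ C |t|^{-2 Re s}` for `|t| ≥ M`
  (from the convergent expansion (2.2) at `∞`);
* `IsAnalyticVector.tendsto_cocompact`: `φ(t) → 0` as `t → ±∞` (`Re s > 0`);
* `IsAnalyticVector.eq_zero_of_periodic`, `IsAnalyticVector.eq_zero_of_lineSlash_upper`: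
  `(V_s^ω)^Γ = 0` as soon as `Γ` contains a translation `(1 c; 0 1)`, `c ≠ 0` — the `H⁰` term
  (5.3) of the long exact sequence, in the line model modulo finite sets;
* `eq_of_eventuallyEq_cofinite`: continuous functions on `ℝ` equal off a finite set are equal
  (how cofinite line-model identities are upgraded).
* `hasFDerivAt_greenOneForm_symm`, `greenSegmentIntegral_triangle` (§2): the Green's form
  `[U, V]` as a Mathlib `1`-form is closed where `U`, `V` are `C²` with `U ΔV = V ΔU` ((1.10c)),
  hence `∫_a^b [U,V] + ∫_b^c [U,V] = ∫_a^c [U,V]` on convex open sets (Mathlib's Poincaré lemma);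
  `greenSegmentIntegral_eq_curveIntegral` bridges to `∫ᶜ`.
* `laplacian_mul` (Leibniz rule for `Δ` on `ℂ`), `hypPoissonKernelCpow_eq_mul`
  (`R(t;z)^s = y^s (z-t)^{-s} conj((z-t)^{-s̄})`), `hypPoissonKernelCpow_eigen` and
  `contDiffOn_hypPoissonKernelCpow` (§3): **`R(t; ·)^s ∈ E_s`**, i.e.
  `y² Δ R(t;·)^s + s(1-s) R(t;·)^s = 0` on `ℍ` ((1.6), p. 10);
* `greenPeriod_add`, `greenPeriod_swap` (§4): path additivity `∫_a^b + ∫_b^c = ∫_a^c` of the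
  period integral `∫ [u, R(t;·)^s]` for `u ∈ E_s^Γ` — the closedness used in (5.4)–(5.5a).
* `wirtingerDz_comp`, `wirtingerDzbar_comp`, `greenForm_comp` (§5): **(1.10a)**
  `[u ∘ g, v ∘ g] = [u, v] ∘ g` for holomorphic `g`; `greenForm_congr`, `greenForm_const_mul`;
* `greenSegmentIntegral_comp_smul` (§6): Möbius change of variables
  `∫_{[a,b]} [U ∘ M_g, V ∘ M_g] = ∫_{[g a, g b]} [U, V]` for `det g > 0` and a closed `[U, V]`
  (image path homotopic to the segment inside `ℍ`; Mathlib's homotopy invariance of `∫ᶜ`);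
* `lineSlash_greenPeriod`, **`lewisZagierCocycle_mul`** (§7): the equivariance
  `(∫_a^b [u, R^s]) | δ = ∫_{δ⁻¹a}^{δ⁻¹b} [u, R^s]` ((2.25) + (1.10a) + invariance of `u`) and the
  **cocycle relation `r_{γδ} = r_γ | δ + r_δ`** ((5.4)) off the pole of `δ` (and mod finite sets).
* §8 (definitions `poissonKernelC`, `ratioKernel`): the complexified kernel
  `R_η(w) = Im w/((η-w)(η-w̄))` ((1.7)) and the **ratio kernel** `(R_η(w)/R_η(z₀))^s` of the
  canonical hybrid model of the companion paper (Bruggeman–Lewis–Zagier, *Function theory related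
  to the group PSL₂(ℝ)*, §4.2, Thm 4.2); `poissonKernelC_moebius` (holomorphic extension of
  (2.25): `R_{gη}(gw) = (cη+d)² R_η(w)`), `ratioKernel_moebius` (exact Möbius invariance);
  `factoredKernel_eigen`, `ratioKernel_eventuallyEq_factored`, **`ratioKernel_eigen`**
  (`w ↦ (R_η(w)/R_η(z₀))^s` is a `λ_s`-eigenfunction off `η`, `η̄` and the cut),
  `contDiffAt_ratioKernel`; the segment geometry `re_segment_ratio_pos`, `ratioBase_segment`
  (along `[z₀, η]` the base is `(1-τ)⁻¹ W` with `Re W > 0`), and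
  `greenSegmentIntegral_ratioKernel_triangle` (closedness of `[u, (R_η/R_η(z₀))^s]`).

## Road map to `BruggemanLewisZagier2015_prop_5_1_holds` (in progress)

Following the companion paper's canonical model with the single base point `z₀`: the
representative `h(η) = u(z₀) + ∫_{z₀}^{η} [u, (R_η/R_η(z₀))^s]` (`η ∈ ℍ`) is holomorphic, and
`Φ(η) = φ(η)/R_η(z₀)^s` (the analytic vector in the hybrid normalisation) is holomorphic across
`P¹(ℝ)`; the coboundary hypothesis makes `D = u(z₀) + Φ - h` satisfy
`D(γη) = (R_{γη}(γz₀)/R_{γη}(z₀))^s D(η)`, and an argument-principle computation on a hyperbolic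
annulus around `z₀` displaced by a far element of `Γ` (the paper's `H_s^Γ = 0`, p. 31) forces
`D = 0`; then `h` is entire on `P¹(ℂ)`, hence constant `= h(z̄₀) = 0`, so `u(z₀) = h(z₀) = 0`.

## References

* [BruggemanLewisZagier2015] R. Bruggeman, J. Lewis, D. Zagier, *Period functions for Maass wave
  forms and cohomology*, Mem. Amer. Math. Soc. 237 (2015), no. 1118, doi:10.1090/memo/1118:
  (1.6)–(1.7) p. 10; (1.9)–(1.10) p. 11; (2.2) p. 12; (2.25) p. 16; (2.12) p. 14; (5.3)–(5.4) pp. 28–29; Proposition 5.1 pp. 30–31.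
-/

noncomputable section

namespace Literature.NumberTheory.Automorphic

open _root_.UpperHalfPlane _root_.Complex _root_.Filter _root_.Set _root_.MeasureTheory
open scoped MatrixGroups Topology ComplexConjugate
open Laplacian

/-! ## 1. Decay of analytic vectors at `∞` and `H⁰` vanishing

Infrastructure for the printed proof of Proposition 5.1 (p. 31) and its long exact sequence
`0 → (V_s^ω)^Γ → H_s^Γ → (V_s^{-ω})^Γ → H¹(Γ; V_s^ω)` ((2.12), (5.3)): an analytic vector is
`O(|t|^{-2 Re s})` at `∞`, hence tends to `0`, hence a translation-invariant analytic vector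
vanishes (`(V_s^ω)^Γ = 0` for `Γ ∋` a parabolic fixing `∞`). -/

section AnalyticVectorDecay

/-- **Decay of analytic vectors at `∞`**: if `φ ∈ V_s^ω` then `‖φ(t)‖ ≤ C |t|^{-2 Re s}` for
`|t|` large (the expansion (2.2) starts with `|t|^{-2s} c₀`). [cite: BruggemanLewisZagier2015, (2.2) p. 12] -/
theorem IsAnalyticVector.exists_norm_le {s : ℂ} {φ : ℝ → ℂ} (h : IsAnalyticVector s φ) :
    ∃ C M : ℝ, 0 < M ∧ ∀ t : ℝ, M ≤ |t| → ‖φ t‖ ≤ C * |t| ^ (-(2 * s.re)) := by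
  obtain ⟨-, ψ, hψ, hψφ⟩ := h
  -- `ψ` is bounded near `0`
  have hcont : ContinuousAt ψ 0 := hψ.continuousAt
  obtain ⟨δ, hδ, hB⟩ : ∃ δ > 0, ∀ τ : ℝ, |τ| < δ → ‖ψ τ‖ ≤ ‖ψ 0‖ + 1 := by
    obtain ⟨δ, hδ, hδ'⟩ := Metric.continuousAt_iff.mp hcont 1 one_pos
    refine ⟨δ, hδ, fun τ hτ => ?_⟩
    have hd : dist (ψ τ) (ψ 0) < 1 := hδ' (by simpa [Real.dist_eq] using hτ)
    rw [dist_eq_norm] at hd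
    calc ‖ψ τ‖ = ‖ψ 0 + (ψ τ - ψ 0)‖ := by congr 1; ring
      _ ≤ ‖ψ 0‖ + ‖ψ τ - ψ 0‖ := norm_add_le _ _
      _ ≤ ‖ψ 0‖ + 1 := by linarith
  refine ⟨‖ψ 0‖ + 1, 2 / δ, by positivity, fun t ht => ?_⟩
  have htpos : 0 < |t| := lt_of_lt_of_le (by positivity) ht
  have ht0 : t ≠ 0 := abs_pos.mp htpos
  set τ : ℝ := -1 / t with hτ
  have hτ0 : τ ≠ 0 := by rw [hτ]; exact div_ne_zero (by norm_num) ht0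
  have hτabs : |τ| = |t|⁻¹ := by rw [hτ, abs_div, abs_neg, abs_one, one_div]
  have hτlt : |τ| < δ := by
    rw [hτabs]
    have h2 : 2 / δ ≤ |t| := ht
    have : |t|⁻¹ ≤ δ / 2 := by
      rw [inv_le_comm₀ htpos (by positivity)]
      calc (δ / 2)⁻¹ = 2 / δ := by rw [inv_div]
        _ ≤ |t| := h2
    linarith
  have hrel : ψ τ = ((|τ| : ℝ) : ℂ) ^ (-(2 * s)) * φ t := by
    rw [hψφ τ hτ0]
    congr 2
    rw [hτ]; field_simp
  have hnormpow : ‖((|τ| : ℝ) : ℂ) ^ (-(2 * s))‖ = |t| ^ (2 * s.re) := by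
    rw [Complex.norm_cpow_eq_rpow_re_of_pos (abs_pos.mpr hτ0), hτabs]
    simp only [Complex.neg_re, Complex.mul_re, Complex.re_ofNat, Complex.im_ofNat, zero_mul,
      sub_zero]
    rw [Real.inv_rpow (abs_nonneg t), ← Real.rpow_neg (abs_nonneg t), neg_neg]
  have hkey : ‖φ t‖ = |t| ^ (-(2 * s.re)) * ‖ψ τ‖ := by
    rw [hrel, norm_mul, hnormpow, ← mul_assoc, ← Real.rpow_add htpos]
    simp
  rw [hkey, mul_comm]
  exact mul_le_mul_of_nonneg_right (hB τ hτlt) (Real.rpow_nonneg (abs_nonneg t) _)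

/-- An analytic vector tends to `0` at `±∞` when `Re s > 0`. [cite: BruggemanLewisZagier2015, (2.2) p. 12] -/
theorem IsAnalyticVector.tendsto_cocompact {s : ℂ} {φ : ℝ → ℂ} (h : IsAnalyticVector s φ)
    (hs : 0 < s.re) : Tendsto φ (cocompact ℝ) (𝓝 0) := by
  obtain ⟨C, M, -, hB⟩ := h.exists_norm_le
  rw [tendsto_zero_iff_norm_tendsto_zero]
  have hlim : Tendsto (fun t : ℝ => C * |t| ^ (-(2 * s.re))) (cocompact ℝ) (𝓝 0) := by
    have h1 : Tendsto (fun t : ℝ => |t| ^ (-(2 * s.re))) (cocompact ℝ) (𝓝 0) := by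
      have habs : Tendsto (fun t : ℝ => |t|) (cocompact ℝ) atTop := by
        have := (tendsto_norm_cocompact_atTop (E := ℝ))
        refine this.congr (fun t => ?_)
        exact Real.norm_eq_abs t
      have := (tendsto_rpow_neg_atTop (by linarith : 0 < 2 * s.re)).comp habs
      refine this.congr' (Eventually.of_forall fun t => ?_)
      simp [Real.rpow_neg (abs_nonneg t)]
    simpa using h1.const_mul C
  refine squeeze_zero' (Eventually.of_forall fun t => norm_nonneg _) ?_ hlim
  have : ∀ᶠ t : ℝ in cocompact ℝ, M ≤ |t| := by
    rw [cocompact_eq_atBot_atTop]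
    refine ⟨?_, ?_⟩
    · filter_upwards [eventually_le_atBot (-M)] with t ht
      have : M ≤ -t := by linarith
      exact this.trans (neg_le_abs t)
    · filter_upwards [eventually_ge_atTop M] with t ht
      exact ht.trans (le_abs_self t)
  filter_upwards [this] with t ht using hB t ht

/-- **`H⁰` vanishing for a translation**: an analytic vector that is periodic under a
non-trivial translation `t ↦ t + c` (the line-model action of the parabolic `(1 c; 0 1)`)
vanishes identically when `Re s > 0`: it is constant along `t + n c → ∞` and tends to `0` there.
This is `(V_s^ω)^Γ = 0` ((5.3)) for `Γ ∋` a translation. [cite: BruggemanLewisZagier2015, (5.3) p. 28] -/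
theorem IsAnalyticVector.eq_zero_of_periodic {s : ℂ} {φ : ℝ → ℂ} (h : IsAnalyticVector s φ)
    (hs : 0 < s.re) {c : ℝ} (hc : c ≠ 0) (hper : Function.Periodic φ c) : φ = 0 := by
  funext t
  have hlim := h.tendsto_cocompact hs
  -- the sequence `t + n c` tends to `±∞`; along it `φ` is constant `= φ t`
  have hseq : Tendsto (fun n : ℕ => t + n * c) atTop (cocompact ℝ) := by
    rw [cocompact_eq_atBot_atTop]
    rcases lt_or_gt_of_ne hc with hneg | hpos
    · refine Tendsto.mono_right ?_ le_sup_left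
      have h1 : Tendsto (fun n : ℕ => (n : ℝ) * c) atTop atBot :=
        tendsto_natCast_atTop_atTop.atTop_mul_const_of_neg hneg
      exact tendsto_atBot_add_const_left _ t h1
    · refine Tendsto.mono_right ?_ le_sup_right
      have h1 : Tendsto (fun n : ℕ => (n : ℝ) * c) atTop atTop :=
        tendsto_natCast_atTop_atTop.atTop_mul_const hpos
      exact tendsto_atTop_add_const_left _ t h1
  have hconst : ∀ n : ℕ, φ (t + n * c) = φ t := fun n => hper.nat_mul n t
  have h1 : Tendsto (fun n : ℕ => φ (t + n * c)) atTop (𝓝 0) := hlim.comp hseq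
  have h2 : Tendsto (fun n : ℕ => φ (t + n * c)) atTop (𝓝 (φ t)) := by
    simp only [hconst]; exact tendsto_const_nhds
  exact tendsto_nhds_unique h2 h1

/-- The translation `(1 c; 0 1)` acts on the line model by `φ ↦ φ(· + c)`.
[cite: BruggemanLewisZagier2015, (2.1) p. 11] -/
theorem lineSlash_of_upper {γ : GL (Fin 2) ℝ} {c : ℝ}
    (h00 : (γ 0 0 : ℝ) = 1) (h01 : (γ 0 1 : ℝ) = c) (h10 : (γ 1 0 : ℝ) = 0) (h11 : (γ 1 1 : ℝ) = 1)
    (s : ℂ) (φ : ℝ → ℂ) (t : ℝ) : lineSlash s γ φ t = φ (t + c) := by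
  rw [lineSlash_apply, h00, h01, h10, h11]
  simp

/-- `(V_s^ω)^Γ = 0` for `Γ` containing a non-trivial translation, in the line model modulo
finite sets: an analytic vector `φ` with `φ | (1 c; 0 1) = φ` off a finite set (`c ≠ 0`,
`Re s > 0`) is zero. [cite: BruggemanLewisZagier2015, (5.3) p. 28] -/
theorem IsAnalyticVector.eq_zero_of_lineSlash_upper {s : ℂ} {φ : ℝ → ℂ}
    (h : IsAnalyticVector s φ) (hs : 0 < s.re) {γ : GL (Fin 2) ℝ} {c : ℝ} (hc : c ≠ 0)
    (h00 : (γ 0 0 : ℝ) = 1) (h01 : (γ 0 1 : ℝ) = c) (h10 : (γ 1 0 : ℝ) = 0) (h11 : (γ 1 1 : ℝ) = 1)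
    (hinv : ∀ᶠ t in cofinite, lineSlash s γ φ t = φ t) : φ = 0 := by
  have hcontφ : Continuous φ := by
    rw [continuous_iff_continuousAt]
    exact fun t => (h.1 t (mem_univ t)).continuousAt
  -- upgrade the cofinite identity to an identity of continuous functions
  have hper : Function.Periodic φ c := by
    have heq : (fun t => φ (t + c)) = φ := by
      refine eq_of_eventually_cofinite_of_continuous (hcontφ.comp (continuous_add_const c))
        hcontφ ?_
      filter_upwards [hinv] with t ht
      rwa [lineSlash_of_upper h00 h01 h10 h11] at ht
    intro t
    exact congrFun heq t
  exact h.eq_zero_of_periodic hs hc hper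
  where
  /-- Two continuous functions `ℝ → ℂ` that agree off a finite set agree everywhere. -/
  eq_of_eventually_cofinite_of_continuous {f g : ℝ → ℂ} (hf : Continuous f)
      (hg : Continuous g) (hfg : ∀ᶠ t in cofinite, f t = g t) : f = g := by
    have hfin : {t | f t = g t}ᶜ.Finite := by
      have := Filter.eventually_cofinite.mp hfg
      simpa [compl_setOf] using this
    have hdense : Dense {t | f t = g t} := by
      simpa using Set.Countable.dense_compl ℝ hfin.countable
    exact Continuous.ext_on hdense hf hg fun t ht => ht

/-- Two continuous functions `ℝ → ℂ` that agree off a finite set agree everywhere (identities in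
the line model are stated modulo finite sets, (2.22)). [folklore] -/
theorem eq_of_eventuallyEq_cofinite {f g : ℝ → ℂ} (hf : Continuous f) (hg : Continuous g)
    (h : ∀ᶠ t in cofinite, f t = g t) : f = g :=
  IsAnalyticVector.eq_zero_of_lineSlash_upper.eq_of_eventually_cofinite_of_continuous hf hg h

end AnalyticVectorDecay

/-! ## 2. The Green's form is closed for `λ`-eigenfunctions with the same `λ` ((1.10c))

We view `[U, V] = U_z V dz + U V_{z̄} dz̄` as a Mathlib `1`-form `ω : ℂ → ℂ →L[ℝ] ℂ`,
`ω w = (U_z V)(w) • id + (U V_{z̄})(w) • conj`, compute its derivative for `C²` functions and show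
that `dω` is symmetric exactly when `U ΔV = V ΔU` (`d[u, v] = (u Δv - v Δu) dμ / 2i`, (1.10c)),
and deduce from Mathlib's Poincaré lemma on convex sets the additivity of the segment integrals
`∫_a^b [U, V] + ∫_b^c [U, V] = ∫_a^c [U, V]` over triangles in a convex open set. -/

section GreenClosed

/-- An `ℝ`-bilinear map `ℂ × ℂ → ℂ` is symmetric as soon as it is symmetric on the basis pair
`(1, i)`. [folklore] -/
theorem clm_symm_of_apply_one_I (T : ℂ →L[ℝ] ℂ →L[ℝ] ℂ) (hT : T 1 Complex.I = T Complex.I 1) (k l : ℂ) :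
    T k l = T l k := by
  have e : ∀ z : ℂ, z = z.re • (1 : ℂ) + z.im • Complex.I := fun z => by
    apply Complex.ext <;> simp
  conv_lhs => rw [e k, e l]
  conv_rhs => rw [e l, e k]
  simp only [map_add, map_smul, add_apply, smul_apply, hT]
  simp only [Complex.real_smul]
  ring

/-- A real-linear map `L : ℂ → ℂ` decomposes as `L k = L_z k + L_{z̄} k̄` with the Wirtinger
components `L_z = (L 1 - i L i)/2`, `L_{z̄} = (L 1 + i L i)/2`. [folklore] -/
theorem clm_apply_eq_wirtinger (L : ℂ →L[ℝ] ℂ) (k : ℂ) :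
    L k = (L 1 - Complex.I * L Complex.I) / 2 * k + (L 1 + Complex.I * L Complex.I) / 2 * conj k := by
  have e : k = k.re • (1 : ℂ) + k.im • Complex.I := by apply Complex.ext <;> simp
  conv_lhs => rw [e]
  rw [map_add, map_smul, map_smul]
  simp only [Complex.real_smul]
  apply Complex.ext
  · simp; ring
  · simp; ring

variable {U V : ℂ → ℂ} {O : Set ℂ}

/-- **Closedness of the Green's form** ((1.10c)): on an open set where `U`, `V` are `C²` and
`U ΔV = V ΔU` (e.g. two `λ_s`-eigenfunctions of the hyperbolic Laplacian), the `1`-form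
`w ↦ (U_z V)(w) • id + (U V_z̄)(w) • conj` — whose value on a tangent vector `h` is
`greenForm U V w h` — has a symmetric derivative at every point.
[cite: BruggemanLewisZagier2015, (1.10c) p. 11] -/
theorem hasFDerivAt_greenOneForm_symm (hO : IsOpen O) (hU : ContDiffOn ℝ 2 U O)
    (hV : ContDiffOn ℝ 2 V O) {w : ℂ} (hw : w ∈ O) (hΔ : U w * (Δ V) w = V w * (Δ U) w) :
    ∃ D : ℂ →L[ℝ] ℂ →L[ℝ] ℂ,
      HasFDerivAt (fun w => (wirtingerDz U w * V w) • ContinuousLinearMap.id ℝ ℂ +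
        (U w * wirtingerDzbar V w) • (Complex.conjCLE : ℂ →L[ℝ] ℂ)) D w ∧
      ∀ k l : ℂ, D k l = D l k := by
  -- `U`, `V` are `C²` at `w`
  have hU2 : ContDiffAt ℝ 2 U w := hU.contDiffAt (hO.mem_nhds hw)
  have hV2 : ContDiffAt ℝ 2 V w := hV.contDiffAt (hO.mem_nhds hw)
  have hU2' : ContDiffAt ℝ (1 + 1) U w := by simpa [one_add_one_eq_two] using hU2
  have hV2' : ContDiffAt ℝ (1 + 1) V w := by simpa [one_add_one_eq_two] using hV2
  -- first derivatives as functions, differentiable at `w`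
  set DU : ℂ → ℂ →L[ℝ] ℂ := fderiv ℝ U with hDU
  set DV : ℂ → ℂ →L[ℝ] ℂ := fderiv ℝ V with hDV
  have hDU1 : ContDiffAt ℝ 1 DU w := hU2'.fderiv_right_succ
  have hDV1 : ContDiffAt ℝ 1 DV w := hV2'.fderiv_right_succ
  have hDUd : HasFDerivAt DU (fderiv ℝ DU w) w := (hDU1.differentiableAt one_ne_zero).hasFDerivAt
  have hDVd : HasFDerivAt DV (fderiv ℝ DV w) w := (hDV1.differentiableAt one_ne_zero).hasFDerivAt
  have hUd : HasFDerivAt U (DU w) w := (hU2.differentiableAt two_ne_zero).hasFDerivAt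
  have hVd : HasFDerivAt V (DV w) w := (hV2.differentiableAt two_ne_zero).hasFDerivAt
  set D2U : ℂ →L[ℝ] ℂ →L[ℝ] ℂ := fderiv ℝ DU w with hD2U
  set D2V : ℂ →L[ℝ] ℂ →L[ℝ] ℂ := fderiv ℝ DV w with hD2V
  -- symmetry of second derivatives
  have hsU : ∀ a b : ℂ, D2U a b = D2U b a := fun a b =>
    hU2.isSymmSndFDerivAt (by simp) a b
  have hsV : ∀ a b : ℂ, D2V a b = D2V b a := fun a b =>
    hV2.isSymmSndFDerivAt (by simp) a b
  -- the Laplacians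
  have hLU : (Δ U) w = D2U 1 1 + D2U Complex.I Complex.I := by
    rw [InnerProductSpace.laplacian_eq_iteratedFDeriv_complexPlane]
    simp only [iteratedFDeriv_two_apply]
    rfl
  have hLV : (Δ V) w = D2V 1 1 + D2V Complex.I Complex.I := by
    rw [InnerProductSpace.laplacian_eq_iteratedFDeriv_complexPlane]
    simp only [iteratedFDeriv_two_apply]
    rfl
  -- derivatives of `w ↦ DU w v` for a fixed vector `v`
  have hDUv : ∀ v : ℂ, HasFDerivAt (fun x => DU x v) (D2U.flip v) w := fun v => by
    have := hDUd.clm_apply (hasFDerivAt_const v w)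
    refine this.congr_fderiv ?_
    ext k
    simp [hD2U]
  have hDVv : ∀ v : ℂ, HasFDerivAt (fun x => DV x v) (D2V.flip v) w := fun v => by
    have := hDVd.clm_apply (hasFDerivAt_const v w)
    refine this.congr_fderiv ?_
    ext k
    simp [hD2V]
  -- Wirtinger derivatives as functions
  have hWz : HasFDerivAt (wirtingerDz U)
      ((2 : ℂ)⁻¹ • (D2U.flip 1 - Complex.I • D2U.flip Complex.I)) w := by
    have h1 := ((hDUv 1).sub ((hDUv Complex.I).const_mul Complex.I)).const_mul (2 : ℂ)⁻¹
    refine (h1.congr_fderiv ?_).congr_of_eventuallyEq ?_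
    · ext k; simp [smul_sub]
    · filter_upwards with x
      simp [wirtingerDz, hDU, div_eq_inv_mul]
  have hWzb : HasFDerivAt (wirtingerDzbar V)
      ((2 : ℂ)⁻¹ • (D2V.flip 1 + Complex.I • D2V.flip Complex.I)) w := by
    have h1 := ((hDVv 1).add ((hDVv Complex.I).const_mul Complex.I)).const_mul (2 : ℂ)⁻¹
    refine (h1.congr_fderiv ?_).congr_of_eventuallyEq ?_
    · ext k; simp [smul_add]
    · filter_upwards with x
      simp [wirtingerDzbar, hDV, div_eq_inv_mul]
  -- the coefficients `A = U_z V`, `B = U V_z̄`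
  have hA := hWz.mul hVd
  have hB := hUd.mul hWzb
  have hω := (hA.smul_const (ContinuousLinearMap.id ℝ ℂ)).add
    (hB.smul_const (Complex.conjCLE : ℂ →L[ℝ] ℂ))
  refine ⟨_, hω, ?_⟩
  -- symmetry: reduce to the basis pair `(1, Complex.I)` and compute
  intro k l
  apply clm_symm_of_apply_one_I
  have hsU' : D2U Complex.I 1 = D2U 1 Complex.I := hsU Complex.I 1
  have hsV' : D2V Complex.I 1 = D2V 1 Complex.I := hsV Complex.I 1
  simp only [add_apply, ContinuousLinearMap.smulRight_apply,
    smul_apply, ContinuousLinearMap.id_apply, ContinuousLinearEquiv.coe_coe,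
    Complex.conjCLE_apply, sub_apply, ContinuousLinearMap.flip_apply,
    smul_eq_mul, map_one, Complex.conj_I, hsU', hsV']
  -- Wirtinger values at `w`
  simp only [wirtingerDz, wirtingerDzbar, hDU, hDV]
  rw [hLU, hLV] at hΔ
  ring_nf
  simp only [Complex.I_sq]
  linear_combination (-Complex.I / 2) * hΔ

/-- The segment integral `∫_a^b [U, V]` of the file `BLZPeriodCocycle` is the curve integral of
the `1`-form `w ↦ (U_z V)(w) • id + (U V_z̄)(w) • conj` along Mathlib's `Path.segment a b`.
[cite: BruggemanLewisZagier2015, (1.9) p. 11] -/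
theorem greenSegmentIntegral_eq_curveIntegral (U V : ℂ → ℂ) (a b : ℂ) :
    greenSegmentIntegral U V a b =
      ∫ᶜ x in Path.segment a b, ((wirtingerDz U x * V x) • ContinuousLinearMap.id ℝ ℂ +
        (U x * wirtingerDzbar V x) • (Complex.conjCLE : ℂ →L[ℝ] ℂ)) := by
  rw [curveIntegral_segment]
  unfold greenSegmentIntegral
  refine intervalIntegral.integral_congr fun τ _ => ?_
  simp only [greenForm, AffineMap.lineMap_apply_module, add_apply, smul_apply,
    ContinuousLinearMap.id_apply, ContinuousLinearEquiv.coe_coe, Complex.conjCLE_apply,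
    smul_eq_mul, Complex.real_smul]
  push_cast
  ring

/-- **Additivity of `∫ [U, V]` over triangles** (path independence on convex sets): if `U`, `V`
are `C²` on a convex open set `O ⊆ ℂ` with `U ΔV = V ΔU` there — in particular for two
`λ_s`-eigenfunctions of the hyperbolic Laplacian on `ℍ`, by (1.10c) — then
`∫_a^b [U, V] + ∫_b^c [U, V] = ∫_a^c [U, V]` for the Euclidean segments between any
`a, b, c ∈ O`. This is the closedness "`[u, v]` is a closed `1`-form on `U` if `u, v ∈ E_s(U)`"
(p. 11) in the form used for the cocycle relation (5.4) and the change of base point.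
[cite: BruggemanLewisZagier2015, (1.10c) p. 11] -/
theorem greenSegmentIntegral_triangle (hO : IsOpen O) (hOc : Convex ℝ O)
    (hU : ContDiffOn ℝ 2 U O) (hV : ContDiffOn ℝ 2 V O)
    (hΔ : ∀ w ∈ O, U w * (Δ V) w = V w * (Δ U) w) {a b c : ℂ}
    (ha : a ∈ O) (hb : b ∈ O) (hc : c ∈ O) :
    greenSegmentIntegral U V a b + greenSegmentIntegral U V b c =
      greenSegmentIntegral U V a c := by
  set ω : ℂ → ℂ →L[ℝ] ℂ := fun w => (wirtingerDz U w * V w) • ContinuousLinearMap.id ℝ ℂ +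
    (U w * wirtingerDzbar V w) • (Complex.conjCLE : ℂ →L[ℝ] ℂ) with hω
  have hex : ∀ w ∈ O, ∃ D : ℂ →L[ℝ] ℂ →L[ℝ] ℂ, HasFDerivAt ω D w ∧ ∀ k l : ℂ, D k l = D l k :=
    fun w hw => hasFDerivAt_greenOneForm_symm hO hU hV hw (hΔ w hw)
  choose! D hD using hex
  have h := hOc.curveIntegral_segment_add_eq_of_hasFDerivWithinAt_symmetric (ω := ω) (dω := D)
    (fun x hx => (hD x hx).1.hasFDerivWithinAt) (fun x hx k _ l _ => (hD x hx).2 k l) ha hb hc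
  rw [greenSegmentIntegral_eq_curveIntegral, greenSegmentIntegral_eq_curveIntegral,
    greenSegmentIntegral_eq_curveIntegral]
  exact h

end GreenClosed

/-! ## 3. `R(t; ·)^s ∈ E_s`: the Poisson kernel power is a `λ_s`-eigenfunction ((1.6))

We compute the Euclidean Laplacian of `z ↦ R(t; z)^s = (y/|z-t|²)^s` on `ℍ` by writing it as
`y^s · (z-t)^{-s} · conj((z-t)^{-s̄})` (holomorphic times antiholomorphic times a function of
`y`), with a Leibniz rule for `Δ` and the harmonicity of (anti)holomorphic functions. -/

section LaplacianCalculus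

/-- `Δ f = D²f(1,1) + D²f(i,i)` on `ℂ ≅ ℝ²`. [folklore] -/
theorem laplacian_eq_snd_fderiv (f : ℂ → ℂ) (x : ℂ) :
    (Δ f) x = fderiv ℝ (fderiv ℝ f) x 1 1 +
      fderiv ℝ (fderiv ℝ f) x Complex.I Complex.I := by
  rw [InnerProductSpace.laplacian_eq_iteratedFDeriv_complexPlane]
  simp only [iteratedFDeriv_two_apply]
  rfl

/-- **Leibniz rule for the Laplacian** of a product of two `C²` functions `ℂ → ℂ`:
`Δ(fg) = f Δg + g Δf + 2 ∇f · ∇g` with `∇f · ∇g = f_x g_x + f_y g_y` (complex-bilinear).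
[folklore] -/
theorem laplacian_mul {f g : ℂ → ℂ} {x : ℂ} (hf : ContDiffAt ℝ 2 f x) (hg : ContDiffAt ℝ 2 g x) :
    (Δ (f * g)) x = f x * (Δ g) x + g x * (Δ f) x +
      2 * (fderiv ℝ f x 1 * fderiv ℝ g x 1 +
        fderiv ℝ f x Complex.I * fderiv ℝ g x Complex.I) := by
  have hf' : ∀ᶠ y in 𝓝 x, ContDiffAt ℝ 2 f y := hf.eventually (by simp)
  have hg' : ∀ᶠ y in 𝓝 x, ContDiffAt ℝ 2 g y := hg.eventually (by simp)
  -- the first derivative of the product, near `x`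
  have hprod : fderiv ℝ (f * g) =ᶠ[𝓝 x] (f • fderiv ℝ g + g • fderiv ℝ f) := by
    filter_upwards [hf', hg'] with y hfy hgy
    rw [Pi.add_apply, Pi.smul_apply', Pi.smul_apply']
    exact ((hfy.differentiableAt two_ne_zero).hasFDerivAt.mul
      (hgy.differentiableAt two_ne_zero).hasFDerivAt).fderiv
  -- second derivatives at `x`
  have hf2 : ContDiffAt ℝ (1 + 1) f x := by simpa [one_add_one_eq_two] using hf
  have hg2 : ContDiffAt ℝ (1 + 1) g x := by simpa [one_add_one_eq_two] using hg
  have hDf : HasFDerivAt (fderiv ℝ f) (fderiv ℝ (fderiv ℝ f) x) x :=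
    (hf2.fderiv_right_succ.differentiableAt one_ne_zero).hasFDerivAt
  have hDg : HasFDerivAt (fderiv ℝ g) (fderiv ℝ (fderiv ℝ g) x) x :=
    (hg2.fderiv_right_succ.differentiableAt one_ne_zero).hasFDerivAt
  have hfd : HasFDerivAt f (fderiv ℝ f x) x := (hf.differentiableAt two_ne_zero).hasFDerivAt
  have hgd : HasFDerivAt g (fderiv ℝ g x) x := (hg.differentiableAt two_ne_zero).hasFDerivAt
  have hsec := (hfd.smul hDg).add (hgd.smul hDf)
  have hD2 : fderiv ℝ (fderiv ℝ (f * g)) x =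
      f x • fderiv ℝ (fderiv ℝ g) x + (fderiv ℝ f x).smulRight (fderiv ℝ g x) +
        (g x • fderiv ℝ (fderiv ℝ f) x + (fderiv ℝ g x).smulRight (fderiv ℝ f x)) := by
    rw [hprod.fderiv_eq]; exact hsec.fderiv
  rw [laplacian_eq_snd_fderiv, laplacian_eq_snd_fderiv f, laplacian_eq_snd_fderiv g,
    hD2]
  simp only [add_apply, smul_apply, ContinuousLinearMap.smulRight_apply, smul_eq_mul]
  ring

/-- Real Fréchet derivative of a complex-differentiable function: `D F(x) v = v F'(x)`. [folklore] -/
theorem fderiv_real_apply_of_hasDerivAt {F : ℂ → ℂ} {x F' : ℂ} (h : HasDerivAt F F' x) (v : ℂ) :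
    fderiv ℝ F x v = v * F' := by
  rw [(h.hasFDerivAt.restrictScalars ℝ).fderiv]
  simp [smul_eq_mul]

/-- Real Fréchet derivative of `conj ∘ F` for a complex-differentiable `F`:
`D(conj F)(x) v = conj (v F'(x))`. [folklore] -/
theorem fderiv_real_conj_apply_of_hasDerivAt {F : ℂ → ℂ} {x F' : ℂ} (h : HasDerivAt F F' x)
    (v : ℂ) : fderiv ℝ (fun z => conj (F z)) x v = conj (v * F') := by
  have h1 := h.hasFDerivAt.restrictScalars ℝ
  have h2 : HasFDerivAt (fun z => conj (F z))
      ((Complex.conjCLE : ℂ →L[ℝ] ℂ).comp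
        ((ContinuousLinearMap.smulRight (1 : ℂ →L[ℂ] ℂ) F').restrictScalars ℝ)) x :=
    (Complex.conjCLE : ℂ →L[ℝ] ℂ).hasFDerivAt.comp x h1
  rw [h2.fderiv]
  simp [smul_eq_mul]

/-- A function complex-differentiable on an open set is harmonic there: `Δ F = 0`. [folklore] -/
theorem laplacian_eq_zero_of_differentiableOn {F : ℂ → ℂ} {O : Set ℂ} (hO : IsOpen O)
    (hF : DifferentiableOn ℂ F O) {x : ℂ} (hx : x ∈ O) : (Δ F) x = 0 := by
  have hA : AnalyticAt ℂ F x := hF.analyticAt (hO.mem_nhds hx)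
  exact hA.harmonicAt.2.eq_of_nhds

/-- The conjugate of a function complex-differentiable on an open set is harmonic: `Δ (conj F) = 0`.
[folklore] -/
theorem laplacian_conj_eq_zero_of_differentiableOn {F : ℂ → ℂ} {O : Set ℂ} (hO : IsOpen O)
    (hF : DifferentiableOn ℂ F O) {x : ℂ} (hx : x ∈ O) : (Δ (fun z => conj (F z))) x = 0 := by
  have hA : AnalyticAt ℂ F x := hF.analyticAt (hO.mem_nhds hx)
  have := hA.harmonicAt_conj
  exact this.2.eq_of_nhds

/-- `C²`-regularity (over `ℝ`) of a function complex-differentiable on an open set. [folklore] -/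
theorem contDiffAt_real_of_differentiableOn {F : ℂ → ℂ} {O : Set ℂ} (hO : IsOpen O)
    (hF : DifferentiableOn ℂ F O) {x : ℂ} (hx : x ∈ O) (n : WithTop ℕ∞) : ContDiffAt ℝ n F x := by
  have hA : AnalyticAt ℂ F x := hF.analyticAt (hO.mem_nhds hx)
  exact (hA.contDiffAt (n := n)).restrict_scalars ℝ

/-- `C²`-regularity (over `ℝ`) of `conj ∘ F` for `F` complex-differentiable on an open set.
[folklore] -/
theorem contDiffAt_real_conj_of_differentiableOn {F : ℂ → ℂ} {O : Set ℂ} (hO : IsOpen O)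
    (hF : DifferentiableOn ℂ F O) {x : ℂ} (hx : x ∈ O) (n : WithTop ℕ∞) :
    ContDiffAt ℝ n (fun z => conj (F z)) x :=
  ((Complex.conjCLE : ℂ →L[ℝ] ℂ).contDiff.contDiffAt).comp x
    (contDiffAt_real_of_differentiableOn hO hF hx n)

/-- The `ℝ`-linear map `v ↦ Im v` as a `ℂ`-valued continuous linear map. [folklore] -/
theorem hasFDerivAt_im_cpow {s : ℂ} (hs : s ≠ 0) {z : ℂ} (hz : z.im ≠ 0) :
    HasFDerivAt (fun w : ℂ => ((w.im : ℝ) : ℂ) ^ s)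
      ((s * ((z.im : ℝ) : ℂ) ^ (s - 1)) • (Complex.ofRealCLM.comp Complex.imCLM)) z := by
  have h1 : HasDerivAt (fun y : ℝ => (y : ℂ) ^ s) (s * ((z.im : ℝ) : ℂ) ^ (s - 1)) z.im :=
    hasDerivAt_ofReal_cpow_const hz hs
  have h2 := h1.hasFDerivAt.comp z Complex.imCLM.hasFDerivAt
  refine h2.congr_fderiv ?_
  ext v; simp [smul_eq_mul, mul_comm]

/-- `z ↦ (Im z)^s` is real-analytic on `{Im z > 0}`. [folklore] -/
theorem analyticAt_im_cpow (s : ℂ) {z : ℂ} (hz : 0 < z.im) :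
    AnalyticAt ℝ (fun w : ℂ => ((w.im : ℝ) : ℂ) ^ s) z := by
  have h1 : AnalyticAt ℝ (fun y : ℝ => ((id y : ℝ) : ℂ) ^ s) z.im :=
    analyticAt_ofReal_cpow_const analyticAt_id (by simpa using hz) s
  exact AnalyticAt.comp (g := fun y : ℝ => ((id y : ℝ) : ℂ) ^ s) (f := fun w : ℂ => w.im) h1
    (Complex.imCLM.analyticAt z)

/-- First derivatives and Laplacian of `P(z) = (Im z)^s` on `{Im z > 0}`:
`DP(z) v = s y^{s-1} Im v` and `ΔP = s(s-1) y^{s-2}` (`s ≠ 0, 1`). [folklore] -/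
theorem fderiv_laplacian_im_cpow {s : ℂ} (hs : s ≠ 0) (hs1 : s ≠ 1) {z : ℂ} (hz : 0 < z.im) :
    fderiv ℝ (fun w : ℂ => ((w.im : ℝ) : ℂ) ^ s) z 1 = 0 ∧
    fderiv ℝ (fun w : ℂ => ((w.im : ℝ) : ℂ) ^ s) z Complex.I =
      s * ((z.im : ℝ) : ℂ) ^ (s - 1) ∧
    (Δ (fun w : ℂ => ((w.im : ℝ) : ℂ) ^ s)) z = s * (s - 1) * ((z.im : ℝ) : ℂ) ^ (s - 2) := by
  set L₀ : ℂ →L[ℝ] ℂ := Complex.ofRealCLM.comp Complex.imCLM with hL₀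
  have hL₀v : ∀ v : ℂ, L₀ v = ((v.im : ℝ) : ℂ) := fun v => rfl
  -- the first derivative near `z`
  have hD1 : fderiv ℝ (fun w : ℂ => ((w.im : ℝ) : ℂ) ^ s) =ᶠ[𝓝 z]
      fun w => (s * ((w.im : ℝ) : ℂ) ^ (s - 1)) • L₀ := by
    have hopen : ∀ᶠ w in 𝓝 z, 0 < w.im :=
      (Complex.continuous_im.isOpen_preimage _ isOpen_Ioi).mem_nhds hz
    filter_upwards [hopen] with w hw
    exact (hasFDerivAt_im_cpow hs hw.ne').fderiv
  refine ⟨?_, ?_, ?_⟩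
  · rw [(hasFDerivAt_im_cpow hs hz.ne').fderiv]; simp
  · rw [(hasFDerivAt_im_cpow hs hz.ne').fderiv]; simp
  · -- second derivative: differentiate `w ↦ c(w) • L₀` with `c(w) = s (Im w)^{s-1}`
    have hs1' : s - 1 ≠ 0 := sub_ne_zero.mpr hs1
    have hc : HasFDerivAt (fun w : ℂ => s * ((w.im : ℝ) : ℂ) ^ (s - 1))
        (s • (((s - 1) * ((z.im : ℝ) : ℂ) ^ (s - 1 - 1)) • L₀)) z :=
      (hasFDerivAt_im_cpow hs1' hz.ne').const_mul s
    have h2 := hc.smul_const L₀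
    have hD2 : fderiv ℝ (fderiv ℝ (fun w : ℂ => ((w.im : ℝ) : ℂ) ^ s)) z =
        (s • ((s - 1) * ((z.im : ℝ) : ℂ) ^ (s - 1 - 1)) • L₀).smulRight L₀ := by
      rw [hD1.fderiv_eq]; exact h2.fderiv
    rw [laplacian_eq_snd_fderiv, hD2]
    simp only [ContinuousLinearMap.smulRight_apply, smul_apply, hL₀v, smul_eq_mul,
      Complex.one_im, Complex.I_im, Complex.ofReal_zero, Complex.ofReal_one]
    ring_nf

end LaplacianCalculus

section PoissonEigen

/-- `(w w̄)^c = w^c w̄^c` for `w` in the upper half-plane (no branch cut is crossed: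
`arg w + arg w̄ = 0`). [folklore] -/
theorem mul_conj_cpow {w : ℂ} (hw : 0 < w.im) (c : ℂ) :
    (w * conj w) ^ c = w ^ c * (conj w) ^ c := by
  have hw0 : w ≠ 0 := fun h => by simp [h] at hw
  have hwc0 : conj w ≠ 0 := (map_ne_zero _).mpr hw0
  have harg : w.arg ≠ Real.pi := by
    intro h
    rw [Complex.arg_eq_pi_iff] at h
    exact hw.ne' h.2
  have hprod : w * conj w ≠ 0 := mul_ne_zero hw0 hwc0
  rw [Complex.cpow_def_of_ne_zero hprod, Complex.cpow_def_of_ne_zero hw0,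
    Complex.cpow_def_of_ne_zero hwc0, ← Complex.exp_add]
  congr 1
  have hlog : Complex.log (w * conj w) = Complex.log w + Complex.log (conj w) := by
    rw [Complex.log_conj w harg, Complex.add_conj, Complex.mul_conj, ← Complex.ofReal_log
      (Complex.normSq_nonneg w), Complex.normSq_eq_norm_sq, Real.log_pow, Complex.log_re]
    push_cast
    ring
  rw [hlog]
  ring

/-- On `ℍ`, `R(t; z)^s = y^s (z - t)^{-s} conj((z - t)^{-s̄})` (principal branches).
[cite: BruggemanLewisZagier2015, (1.6)–(1.7) p. 10] -/
theorem hypPoissonKernelCpow_eq_mul (s : ℂ) (t : ℝ) {z : ℂ} (hz : 0 < z.im) :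
    hypPoissonKernelCpow s t z =
      ((z.im : ℝ) : ℂ) ^ s * (((z - t) ^ (-s)) * conj ((z - t) ^ (-(conj s)))) := by
  have hw : 0 < (z - (t : ℂ)).im := by simpa using hz
  have hw0 : z - (t : ℂ) ≠ 0 := fun h => by simp [h] at hw
  have harg : (z - (t : ℂ)).arg ≠ Real.pi := by
    intro h
    rw [Complex.arg_eq_pi_iff] at h
    exact hw.ne' h.2
  unfold hypPoissonKernelCpow hypPoissonKernel
  have hnorm : 0 < ‖z - (t : ℂ)‖ ^ 2 := by positivity
  rw [div_eq_mul_inv, Complex.ofReal_mul, Complex.mul_cpow_ofReal_nonneg hz.le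
    (inv_nonneg.mpr hnorm.le)]
  congr 1
  rw [Complex.ofReal_inv, Complex.inv_cpow _ _ (by
      rw [Complex.arg_ofReal_of_nonneg hnorm.le]; exact Real.pi_pos.ne), ← Complex.cpow_neg]
  have hsq : (((‖z - (t : ℂ)‖ ^ 2 : ℝ)) : ℂ) = (z - t) * conj (z - t) := by
    rw [Complex.mul_conj, Complex.normSq_eq_norm_sq]
  rw [hsq, mul_conj_cpow hw]
  congr 1
  rw [Complex.conj_cpow _ _ harg, map_neg]

variable {s : ℂ} {t : ℝ}

/-- The holomorphic factor `(z - t)^{c}` on `ℍ`: differentiable, with derivative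
`c (z - t)^{c - 1}`. [folklore] -/
theorem hasDerivAt_sub_real_cpow (c : ℂ) (t : ℝ) {z : ℂ} (hz : 0 < z.im) :
    HasDerivAt (fun w : ℂ => (w - t) ^ c) (c * (z - t) ^ (c - 1)) z := by
  have h0 : z - (t : ℂ) ∈ Complex.slitPlane := Or.inr (by simpa using hz.ne')
  have := ((hasDerivAt_id z).sub_const (t : ℂ)).cpow_const (c := c) h0
  simpa using this

/-- `w ↦ (w - t)^c` is complex-differentiable on the upper half-plane. [folklore] -/
theorem differentiableOn_sub_real_cpow (c : ℂ) (t : ℝ) :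
    DifferentiableOn ℂ (fun w : ℂ => (w - t) ^ c) {z : ℂ | 0 < z.im} := fun _ hz =>
  (hasDerivAt_sub_real_cpow c t hz).differentiableAt.differentiableWithinAt

/-- **`R(t; ·)^s` is a `λ_s`-eigenfunction on `ℍ`** ("We have `R(t; ·)^s ∈ E_s`", p. 10):
`y² Δ R(t;·)^s + s(1-s) R(t;·)^s = 0` for the Euclidean Laplacian `Δ` (i.e.
`-y²(∂²_x + ∂²_y) R^s = s(1-s) R^s`), for `s ≠ 0, 1`.
[cite: BruggemanLewisZagier2015, (1.6) p. 10] -/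
theorem hypPoissonKernelCpow_eigen (hs0 : s ≠ 0) (hs1 : s ≠ 1) (t : ℝ) {z : ℂ} (hz : 0 < z.im) :
    ((z.im : ℝ) : ℂ) ^ 2 * (Δ (hypPoissonKernelCpow s t)) z +
      s * (1 - s) * hypPoissonKernelCpow s t z = 0 := by
  -- notation
  set O : Set ℂ := {z : ℂ | 0 < z.im} with hO
  have hOo : IsOpen O := isOpen_upperHalfPlaneSet
  have hzO : z ∈ O := hz
  set P : ℂ → ℂ := fun w => ((w.im : ℝ) : ℂ) ^ s with hP
  set F : ℂ → ℂ := fun w => (w - t) ^ (-s) with hF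
  set Ft : ℂ → ℂ := fun w => (w - t) ^ (-(conj s)) with hFt
  set Gc : ℂ → ℂ := fun w => conj (Ft w) with hGc
  -- `V = P * (F * Gc)` on `O`
  have hVeq : ∀ w ∈ O, hypPoissonKernelCpow s t w = (P * (F * Gc)) w := fun w hw => by
    simp only [Pi.mul_apply, hP, hF, hGc, hFt]
    exact hypPoissonKernelCpow_eq_mul s t hw
  have hVev : hypPoissonKernelCpow s t =ᶠ[𝓝 z] P * (F * Gc) :=
    Filter.eventually_of_mem (hOo.mem_nhds hzO) hVeq
  -- regularity of the factors
  have hFd : DifferentiableOn ℂ F O := differentiableOn_sub_real_cpow (-s) t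
  have hFtd : DifferentiableOn ℂ Ft O := differentiableOn_sub_real_cpow (-(conj s)) t
  have hP2 : ContDiffAt ℝ 2 P z := (analyticAt_im_cpow s hz).contDiffAt
  have hF2 : ContDiffAt ℝ 2 F z := contDiffAt_real_of_differentiableOn hOo hFd hzO 2
  have hGc2 : ContDiffAt ℝ 2 Gc z := contDiffAt_real_conj_of_differentiableOn hOo hFtd hzO 2
  have hQ2 : ContDiffAt ℝ 2 (F * Gc) z := hF2.mul hGc2
  -- atoms
  set y : ℂ := ((z.im : ℝ) : ℂ) with hy
  have hy0 : y ≠ 0 := by rw [hy]; exact_mod_cast hz.ne'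
  set w : ℂ := z - t with hw
  have hwim : 0 < w.im := by simpa [hw] using hz
  have hw0 : w ≠ 0 := fun h => by simp [h] at hwim
  set Y2 : ℂ := y ^ (s - 2) with hY2
  set Fm : ℂ := w ^ (-s - 1) with hFm
  set Gm : ℂ := conj (w ^ (-(conj s) - 1)) with hGm
  -- values of the factors at `z`
  have hPz : P z = y ^ 2 * Y2 := by
    simp only [hP, hY2, ← hy]
    rw [show s = (s - 2) + 2 from by ring, Complex.cpow_add _ _ hy0, Complex.cpow_two]
    ring_nf
  have hFz : F z = w * Fm := by
    simp only [hF, hFm, ← hw]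
    rw [show -s = (-s - 1) + 1 from by ring, Complex.cpow_add _ _ hw0, Complex.cpow_one]
    ring_nf
  have hGcz : Gc z = conj w * Gm := by
    simp only [hGc, hFt, hGm, ← hw]
    rw [show -(conj s) = (-(conj s) - 1) + 1 from by ring, Complex.cpow_add _ _ hw0,
      Complex.cpow_one, map_mul]
    ring_nf
  -- derivatives of the factors at `z`
  have hFder : HasDerivAt F (-s * Fm) z := by
    have := hasDerivAt_sub_real_cpow (-s) t hz
    simpa [hF, hFm, hw] using this
  have hFtder : HasDerivAt Ft (-(conj s) * w ^ (-(conj s) - 1)) z := by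
    have := hasDerivAt_sub_real_cpow (-(conj s)) t hz
    simpa [hFt, hw] using this
  have hDF : ∀ v : ℂ, fderiv ℝ F z v = v * (-s * Fm) := fun v =>
    fderiv_real_apply_of_hasDerivAt hFder v
  have hDGc : ∀ v : ℂ, fderiv ℝ Gc z v = conj v * (-s * Gm) := fun v => by
    rw [show Gc = fun w => conj (Ft w) from rfl, fderiv_real_conj_apply_of_hasDerivAt hFtder v]
    simp only [map_mul, map_neg, Complex.conj_conj, hGm]
  obtain ⟨hDP1, hDPI, hΔP⟩ := fderiv_laplacian_im_cpow hs0 hs1 hz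
  have hys1 : y ^ (s - 1) = y * Y2 := by
    rw [hY2, show s - 1 = (s - 2) + 1 from by ring, Complex.cpow_add _ _ hy0, Complex.cpow_one]
    ring
  -- Laplacians of the factors
  have hΔF : (Δ F) z = 0 := laplacian_eq_zero_of_differentiableOn hOo hFd hzO
  have hΔGc : (Δ Gc) z = 0 := laplacian_conj_eq_zero_of_differentiableOn hOo hFtd hzO
  have hΔQ := laplacian_mul hF2 hGc2
  have hDQ : ∀ v : ℂ, fderiv ℝ (F * Gc) z v = F z * fderiv ℝ Gc z v + Gc z * fderiv ℝ F z v := by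
    intro v
    rw [((hF2.differentiableAt two_ne_zero).hasFDerivAt.mul
      (hGc2.differentiableAt two_ne_zero).hasFDerivAt).fderiv]
    simp only [add_apply, smul_apply, smul_eq_mul]
  have hΔV : (Δ (hypPoissonKernelCpow s t)) z = (Δ (P * (F * Gc))) z :=
    (InnerProductSpace.laplacian_congr_nhds hVev).eq_of_nhds
  -- assemble
  rw [hΔV, laplacian_mul hP2 hQ2, hΔQ, hDQ, hDQ, hVeq z hzO]
  simp only [Pi.mul_apply]
  rw [hΔF, hΔGc, hDF, hDF, hDGc, hDGc, hDP1, hDPI, hΔP, hPz, hFz, hGcz, hys1]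
  simp only [map_one, Complex.conj_I]
  have hI2 : Complex.I * Complex.I = -1 := Complex.I_mul_I
  have hwb : conj w = w - 2 * y * Complex.I := by
    apply Complex.ext
    · simp [hy, hw]
    · simp [hy, hw]; ring
  linear_combination (-2 * s ^ 2 * y ^ 3 * Complex.I * Y2 * Fm * Gm) * hwb +
    (2 * s ^ 2 * y ^ 4 * Y2 * Fm * Gm) * hI2

/-- `R(t; ·)^s` is `C²` (indeed real-analytic) on the open upper half-plane. [folklore] -/
theorem contDiffOn_hypPoissonKernelCpow (s : ℂ) (t : ℝ) :
    ContDiffOn ℝ 2 (hypPoissonKernelCpow s t) {z : ℂ | 0 < z.im} := by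
  intro z hz
  have hz' : 0 < z.im := hz
  have hP : ContDiffAt ℝ 2 (fun w : ℂ => ((w.im : ℝ) : ℂ) ^ s) z :=
    (analyticAt_im_cpow s hz').contDiffAt
  have hF : ContDiffAt ℝ 2 (fun w : ℂ => (w - t) ^ (-s)) z :=
    contDiffAt_real_of_differentiableOn isOpen_upperHalfPlaneSet
      (differentiableOn_sub_real_cpow (-s) t) hz 2
  have hG : ContDiffAt ℝ 2 (fun w : ℂ => conj ((w - t) ^ (-(conj s)))) z :=
    contDiffAt_real_conj_of_differentiableOn isOpen_upperHalfPlaneSet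
      (differentiableOn_sub_real_cpow (-(conj s)) t) hz 2
  have h := (hP.mul (hF.mul hG)).contDiffWithinAt (s := {z : ℂ | 0 < z.im})
  refine h.congr (fun w hw => ?_) ?_
  · exact hypPoissonKernelCpow_eq_mul s t hw
  · exact hypPoissonKernelCpow_eq_mul s t hz'

end PoissonEigen

section PeriodAdditivity

/-- **Path additivity of the period integral**: for `u ∈ E_s^Γ` (`s ≠ 0, 1`) and the Poisson
kernel `R(t; ·)^s ∈ E_s`, the Green's form `[u, R(t; ·)^s]` is closed on `ℍ` ((1.10c): both are
`λ_s`-eigenfunctions), so `∫_a^b + ∫_b^c = ∫_a^c` for the Euclidean segments between any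
`a, b, c ∈ ℍ`. This is the path-independence behind the cocycle relation
`r_{γδ} = r_γ | δ + r_δ` and the change of base point ((5.4)–(5.5a)).
[cite: BruggemanLewisZagier2015, (1.10c) p. 11 and (5.5a) p. 29] -/
theorem greenPeriod_add {Γ : Subgroup (GL (Fin 2) ℝ)} {s : ℂ} {u : ℍ → ℂ}
    (hu : IsInvariantEigenfunction Γ s u) (hs0 : s ≠ 0) (hs1 : s ≠ 1) (t : ℝ) (a b c : ℍ) :
    greenPeriod s u a b t + greenPeriod s u b c t = greenPeriod s u a c t := by
  unfold greenPeriod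
  have hO : IsOpen {z : ℂ | 0 < z.im} := isOpen_upperHalfPlaneSet
  refine greenSegmentIntegral_triangle hO (convex_halfSpace_im_gt 0) hu.isC2
    (contDiffOn_hypPoissonKernelCpow s t) (fun w hw => ?_) a.im_pos b.im_pos c.im_pos
  -- both factors are `λ_s`-eigenfunctions: `y² ΔU = -s(1-s) U`, `y² ΔV = -s(1-s) V`
  have hw' : 0 < w.im := hw
  have hV := hypPoissonKernelCpow_eigen hs0 hs1 t hw'
  have hU := hu.eigen ⟨w, hw'⟩
  simp only [hypLaplacian] at hU
  have hUw : u ⟨w, hw'⟩ = (u ∘ ofComplex) w := by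
    simp [UpperHalfPlane.ofComplex_apply_of_im_pos hw']
  replace hU : ((w.im : ℝ) : ℂ) ^ 2 * (Δ (u ∘ ofComplex)) w + s * (1 - s) * (u ∘ ofComplex) w = 0 := by
    rw [← hUw]; exact hU
  have hy : (((w.im : ℝ)) : ℂ) ^ 2 ≠ 0 := by
    have : ((w.im : ℝ) : ℂ) ≠ 0 := by exact_mod_cast hw'.ne'
    exact pow_ne_zero 2 this
  -- `U ΔV = V ΔU` after multiplying by `y²`
  apply mul_left_cancel₀ hy
  have e1 : ((w.im : ℝ) : ℂ) ^ 2 * ((u ∘ ofComplex) w * (Δ (hypPoissonKernelCpow s t)) w) =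
      (u ∘ ofComplex) w * (-(s * (1 - s) * hypPoissonKernelCpow s t w)) := by
    linear_combination ((u ∘ ofComplex) w) * hV
  have e2 : ((w.im : ℝ) : ℂ) ^ 2 * (hypPoissonKernelCpow s t w * (Δ (u ∘ ofComplex)) w) =
      hypPoissonKernelCpow s t w * (-(s * (1 - s) * (u ∘ ofComplex) w)) := by
    linear_combination (hypPoissonKernelCpow s t w) * hU
  rw [e1, e2]
  ring

/-- Reversing a segment changes the sign of the period integral. [folklore] -/
theorem greenPeriod_swap {Γ : Subgroup (GL (Fin 2) ℝ)} {s : ℂ} {u : ℍ → ℂ}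
    (hu : IsInvariantEigenfunction Γ s u) (hs0 : s ≠ 0) (hs1 : s ≠ 1) (t : ℝ) (a b : ℍ) :
    greenPeriod s u b a t = -greenPeriod s u a b t := by
  have h := greenPeriod_add hu hs0 hs1 t a b a
  have h0 : greenPeriod s u a a t = 0 := by simp [greenPeriod]
  rw [h0] at h
  linear_combination h

end PeriodAdditivity

/-! ## 5. Pullback of the Green's form under holomorphic maps ((1.10a)) -/

section Pullback

variable {U V : ℂ → ℂ} {m : ℂ → ℂ} {w m' : ℂ}

/-- Chain rule for `∂/∂z` along a holomorphic map: `(U ∘ m)_z (w) = U_z(m w) · m'(w)`.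
[cite: BruggemanLewisZagier2015, (1.10a) p. 11] -/
theorem wirtingerDz_comp (hU : DifferentiableAt ℝ U (m w)) (hm : HasDerivAt m m' w) :
    wirtingerDz (U ∘ m) w = wirtingerDz U (m w) * m' := by
  have hmf : HasFDerivAt m (((1 : ℂ →L[ℂ] ℂ).smulRight m').restrictScalars ℝ) w :=
    hm.hasFDerivAt.restrictScalars ℝ
  have hcomp : fderiv ℝ (U ∘ m) w = (fderiv ℝ U (m w)).comp
      (((1 : ℂ →L[ℂ] ℂ).smulRight m').restrictScalars ℝ) :=
    (hU.hasFDerivAt.comp w hmf).fderiv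
  set L := fderiv ℝ U (m w) with hL
  have hLk : ∀ k : ℂ, L k = wirtingerDz U (m w) * k + wirtingerDzbar U (m w) * conj k := fun k => by
    rw [clm_apply_eq_wirtinger L k]; rfl
  unfold wirtingerDz
  rw [hcomp]
  simp only [ContinuousLinearMap.comp_apply, ContinuousLinearMap.coe_restrictScalars',
    ContinuousLinearMap.smulRight_apply, one_apply_eq_self, smul_eq_mul, one_mul]
  rw [hLk, hLk]
  simp only [map_mul, Complex.conj_I]
  unfold wirtingerDz
  have hI2 : Complex.I * Complex.I = -1 := Complex.I_mul_I
  linear_combination ((wirtingerDzbar U (m w) * conj m' -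
    (fderiv ℝ U (m w) 1 - Complex.I * fderiv ℝ U (m w) Complex.I) / 2 * m') / 2) * hI2

/-- Chain rule for `∂/∂z̄` along a holomorphic map: `(V ∘ m)_z̄ (w) = V_z̄(m w) · conj(m'(w))`.
[cite: BruggemanLewisZagier2015, (1.10a) p. 11] -/
theorem wirtingerDzbar_comp (hV : DifferentiableAt ℝ V (m w)) (hm : HasDerivAt m m' w) :
    wirtingerDzbar (V ∘ m) w = wirtingerDzbar V (m w) * conj m' := by
  have hmf : HasFDerivAt m (((1 : ℂ →L[ℂ] ℂ).smulRight m').restrictScalars ℝ) w :=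
    hm.hasFDerivAt.restrictScalars ℝ
  have hcomp : fderiv ℝ (V ∘ m) w = (fderiv ℝ V (m w)).comp
      (((1 : ℂ →L[ℂ] ℂ).smulRight m').restrictScalars ℝ) :=
    (hV.hasFDerivAt.comp w hmf).fderiv
  set L := fderiv ℝ V (m w) with hL
  have hLk : ∀ k : ℂ, L k = wirtingerDz V (m w) * k + wirtingerDzbar V (m w) * conj k := fun k => by
    rw [clm_apply_eq_wirtinger L k]; rfl
  unfold wirtingerDzbar
  rw [hcomp]
  simp only [ContinuousLinearMap.comp_apply, ContinuousLinearMap.coe_restrictScalars',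
    ContinuousLinearMap.smulRight_apply, one_apply_eq_self, smul_eq_mul, one_mul]
  rw [hLk, hLk]
  simp only [map_mul, Complex.conj_I]
  unfold wirtingerDzbar
  have hI2 : Complex.I * Complex.I = -1 := Complex.I_mul_I
  linear_combination ((wirtingerDz V (m w) * m' -
    (fderiv ℝ V (m w) 1 + Complex.I * fderiv ℝ V (m w) Complex.I) / 2 * conj m') / 2) * hI2

/-- **BLZ (1.10a): `[u ∘ g, v ∘ g] = [u, v] ∘ g`** for a holomorphic map `g` — the Green's form of
the pulled-back functions at `(w, h)` is the Green's form at the image point `g w` evaluated on the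
image tangent vector `g'(w) h`. [cite: BruggemanLewisZagier2015, (1.10a) p. 11] -/
theorem greenForm_comp (hU : DifferentiableAt ℝ U (m w)) (hV : DifferentiableAt ℝ V (m w))
    (hm : HasDerivAt m m' w) (h : ℂ) :
    greenForm (U ∘ m) (V ∘ m) w h = greenForm U V (m w) (m' * h) := by
  simp only [greenForm, wirtingerDz_comp hU hm, wirtingerDzbar_comp hV hm, Function.comp_apply,
    map_mul]
  ring

/-- The Green's form only depends on the germs of `U`, `V`. [folklore] -/
theorem greenForm_congr {U' V' : ℂ → ℂ} (hU : U =ᶠ[𝓝 w] U') (hV : V =ᶠ[𝓝 w] V') (h : ℂ) :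
    greenForm U V w h = greenForm U' V' w h := by
  simp only [greenForm, wirtingerDz, wirtingerDzbar, hU.fderiv_eq, hV.fderiv_eq, hU.eq_of_nhds,
    hV.eq_of_nhds]

/-- The Green's form is linear in `V` under constant scaling. [folklore] -/
theorem greenForm_const_mul (U V : ℂ → ℂ) (c w h : ℂ) :
    greenForm U (fun z => c * V z) w h = c * greenForm U V w h := by
  simp only [greenForm, wirtingerDzbar]
  rw [show (fun z => c * V z) = c • V from rfl, fderiv_const_smul_field]
  simp only [Pi.smul_apply, smul_apply, smul_eq_mul]
  ring

end Pullback

/-! ## 6. Möbius change of variables in the segment integral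

For `g ∈ GL₂⁺(ℝ)` let `M_g : ℂ → ℂ`, `z ↦ ↑(g • ofComplex z)`, be Mathlib's extension of the action
(holomorphic on `{Im z > 0}`, derivative `det g/(cz+d)²`). For `U`, `V` of class `C²` on `ℍ`
with `U ΔV = V ΔU` (closedness of `[U, V]`), `∫_{[a,b]} [U ∘ M_g, V ∘ M_g] = ∫_{[g a, g b]} [U, V]`:
the pullback identity (1.10a) turns the left side into `∫ [U, V]` over the image path
`M_g ∘ [a, b]`, which is homotopic inside `ℍ` to the segment `[g a, g b]` (Mathlib's homotopy
invariance of curve integrals of closed `C¹` forms). -/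

section MoebiusChange

variable {U V : ℂ → ℂ} {g : GL (Fin 2) ℝ}

/-- The extension `M_g z = ↑(g • ofComplex z)` restricted to `ℍ` is the action. [folklore] -/
theorem smulExtend_apply_of_im_pos (g : GL (Fin 2) ℝ) {z : ℂ} (hz : 0 < z.im) :
    (fun w : ℂ => ((g • ofComplex w : ℍ) : ℂ)) z = ((g • (⟨z, hz⟩ : ℍ) : ℍ) : ℂ) := by
  simp [UpperHalfPlane.ofComplex_apply_of_im_pos hz]

/-- `M_g` is real-`C^n` on the open upper half-plane (`det g > 0`). [folklore] -/
theorem contDiffOn_smulExtend (hg : 0 < g.det.val) (n : WithTop ℕ∞) :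
    ContDiffOn ℝ n (fun w : ℂ => ((g • ofComplex w : ℍ) : ℂ)) {z : ℂ | 0 < z.im} := by
  intro z hz
  have hA := UpperHalfPlane.analyticAt_smul (g := g) hg ⟨z, hz⟩
  exact ((hA.contDiffAt (n := n)).restrict_scalars ℝ).contDiffWithinAt

/-- `M_g` is continuous on the open upper half-plane (`det g > 0`). [folklore] -/
theorem continuousOn_smulExtend (hg : 0 < g.det.val) :
    ContinuousOn (fun w : ℂ => ((g • ofComplex w : ℍ) : ℂ)) {z : ℂ | 0 < z.im} :=
  (contDiffOn_smulExtend hg 0).continuousOn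

/-- The `1`-form `w ↦ (U_z V)(w) • id + (U V_z̄)(w) • conj` is continuous on an open set where
`U`, `V` are `C²`. [folklore] -/
theorem continuousOn_greenOneForm {O : Set ℂ} (hO : IsOpen O) (hU : ContDiffOn ℝ 2 U O)
    (hV : ContDiffOn ℝ 2 V O) :
    ContinuousOn (fun w => (wirtingerDz U w * V w) • ContinuousLinearMap.id ℝ ℂ +
      (U w * wirtingerDzbar V w) • (Complex.conjCLE : ℂ →L[ℝ] ℂ)) O := by
  have hDU : ContinuousOn (fderiv ℝ U) O := hU.continuousOn_fderiv_of_isOpen hO (by norm_num)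
  have hDV : ContinuousOn (fderiv ℝ V) O := hV.continuousOn_fderiv_of_isOpen hO (by norm_num)
  have hUc : ContinuousOn U O := hU.continuousOn
  have hVc : ContinuousOn V O := hV.continuousOn
  have h1 : ContinuousOn (fun w => wirtingerDz U w) O := by
    unfold wirtingerDz
    exact ((hDU.clm_apply continuousOn_const).sub
      (continuousOn_const.mul (hDU.clm_apply continuousOn_const))).div_const _
  have h2 : ContinuousOn (fun w => wirtingerDzbar V w) O := by
    unfold wirtingerDzbar
    exact ((hDV.clm_apply continuousOn_const).add
      (continuousOn_const.mul (hDV.clm_apply continuousOn_const))).div_const _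
  exact ((h1.mul hVc).smul continuousOn_const).add ((hUc.mul h2).smul continuousOn_const)

/-- **Möbius change of variables in `∫ [U, V]`** (consequence of (1.10a) and the closedness
(1.10c)): for `det g > 0` and `U`, `V` of class `C²` on `ℍ` with `U ΔV = V ΔU` there,
`∫_{[a, b]} [U ∘ M_g, V ∘ M_g] = ∫_{[g a, g b]} [U, V]` for all `a, b ∈ ℍ`, where
`M_g z = ↑(g • ofComplex z)`. [cite: BruggemanLewisZagier2015, (1.10a) p. 11] -/
theorem greenSegmentIntegral_comp_smul (hg : 0 < g.det.val)
    (hU : ContDiffOn ℝ 2 U {z : ℂ | 0 < z.im}) (hV : ContDiffOn ℝ 2 V {z : ℂ | 0 < z.im})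
    (hΔ : ∀ w : ℂ, 0 < w.im → U w * (Δ V) w = V w * (Δ U) w) (a b : ℍ) :
    greenSegmentIntegral (U ∘ fun w : ℂ => ((g • ofComplex w : ℍ) : ℂ))
        (V ∘ fun w : ℂ => ((g • ofComplex w : ℍ) : ℂ)) a b =
      greenSegmentIntegral U V ((g • a : ℍ) : ℂ) ((g • b : ℍ) : ℂ) := by
  set O : Set ℂ := {z : ℂ | 0 < z.im} with hO
  have hOo : IsOpen O := isOpen_upperHalfPlaneSet
  set M : ℂ → ℂ := fun w : ℂ => ((g • ofComplex w : ℍ) : ℂ) with hM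
  have hg' : 0 < g.val.det := hg
  -- the segment and its image
  set ℓ : ℝ → ℂ := fun τ => AffineMap.lineMap (a : ℂ) (b : ℂ) τ with hℓ
  have hℓO : ∀ τ ∈ Icc (0 : ℝ) 1, 0 < (ℓ τ).im := fun τ hτ => by
    simp only [hℓ, AffineMap.lineMap_apply_module]
    simp only [Complex.add_im, Complex.real_smul, Complex.mul_im, Complex.ofReal_re,
      Complex.ofReal_im, zero_mul, add_zero]
    have ha : 0 < (a : ℂ).im := a.coe_im_pos
    have hb : 0 < (b : ℂ).im := b.coe_im_pos
    rcases eq_or_lt_of_le hτ.1 with h0 | h0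
    · rw [← h0]; simpa using ha
    · have : 0 ≤ 1 - τ := by linarith [hτ.2]
      nlinarith [mul_nonneg this ha.le, mul_pos h0 hb]
  have hMO : ∀ z : ℂ, 0 < z.im → 0 < (M z).im := fun z hz => by
    simp only [hM]; exact (g • ofComplex z).im_pos
  have hMder : ∀ z : ℂ, 0 < z.im → HasDerivAt M (deriv M z) z := fun z hz =>
    ((UpperHalfPlane.hasStrictDerivAt_smul hg' ⟨z, hz⟩).hasDerivAt).differentiableAt.hasDerivAt
  -- Step 1: pointwise pullback of the integrand
  have hstep1 : greenSegmentIntegral (U ∘ M) (V ∘ M) a b =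
      ∫ τ in (0 : ℝ)..1, greenForm U V (M (ℓ τ)) (deriv M (ℓ τ) * ((b : ℂ) - a)) := by
    unfold greenSegmentIntegral
    refine intervalIntegral.integral_congr fun τ hτ => ?_
    rw [uIcc_of_le zero_le_one] at hτ
    have hℓτ : (1 - (τ : ℂ)) * (a : ℂ) + (τ : ℂ) * (b : ℂ) = ℓ τ := by
      simp only [hℓ, AffineMap.lineMap_apply_module, Complex.real_smul]; push_cast; ring
    simp only [hℓτ]
    have hz := hℓO τ hτ
    exact greenForm_comp ((hU.contDiffAt (hOo.mem_nhds (hMO _ hz))).differentiableAt two_ne_zero)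
      ((hV.contDiffAt (hOo.mem_nhds (hMO _ hz))).differentiableAt two_ne_zero) (hMder _ hz) _
  -- the image path
  have hMc : ContinuousOn M O := continuousOn_smulExtend hg
  let γ₁ : Path (M a) (M b) :=
    { toFun := fun τ : unitInterval => M (ℓ τ)
      continuous_toFun := by
        refine hMc.comp_continuous (by simp only [hℓ]; fun_prop) fun τ => hℓO τ τ.2
      source' := by simp [hℓ]
      target' := by simp [hℓ] }
  have hγ₁ : ∀ τ : unitInterval, γ₁ τ = M (ℓ τ) := fun τ => rfl
  -- the 1-form
  set Ω : ℂ → ℂ →L[ℝ] ℂ := fun w => (wirtingerDz U w * V w) • ContinuousLinearMap.id ℝ ℂ +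
    (U w * wirtingerDzbar V w) • (Complex.conjCLE : ℂ →L[ℝ] ℂ) with hΩ
  have hΩapply : ∀ w h : ℂ, Ω w h = greenForm U V w h := fun w h => by
    simp only [hΩ, greenForm, add_apply, smul_apply, ContinuousLinearMap.id_apply,
      ContinuousLinearEquiv.coe_coe, Complex.conjCLE_apply, smul_eq_mul]
  -- Step 2: the integral over the image path is the curve integral of `Ω` along `γ₁`
  have hstep2 : ∫ᶜ x in γ₁, Ω x =
      ∫ τ in (0 : ℝ)..1, greenForm U V (M (ℓ τ)) (deriv M (ℓ τ) * ((b : ℂ) - a)) := by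
    rw [curveIntegral_eq_intervalIntegral_deriv]
    apply intervalIntegral.integral_congr_ae_restrict
    rw [uIoc_of_le zero_le_one, ← restrict_Ioo_eq_restrict_Ioc]
    filter_upwards [ae_restrict_mem (by measurability)] with τ hτ
    have hloc : γ₁.extend =ᶠ[𝓝 τ] fun τ' => M (ℓ τ') := by
      filter_upwards [Icc_mem_nhds hτ.1 hτ.2] with τ' hτ'
      rw [Path.extend_apply γ₁ hτ']
      rfl
    have hd : HasDerivAt (fun τ' : ℝ => M (ℓ τ')) (deriv M (ℓ τ) * ((b : ℂ) - a)) τ := by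
      have h1 : HasDerivAt ℓ ((b : ℂ) - a) τ := by
        simp only [hℓ]; exact AffineMap.hasDerivAt_lineMap
      exact (hMder _ (hℓO τ (Ioo_subset_Icc_self hτ))).comp τ h1
    rw [hloc.deriv_eq, hd.deriv, hloc.eq_of_nhds, hΩapply]
  -- Step 3: the right-hand side is the curve integral along the segment `[g a, g b]`
  have hMa : M a = ((g • a : ℍ) : ℂ) := by simp [hM]
  have hMb : M b = ((g • b : ℍ) : ℂ) := by simp [hM]
  have hstep3 : greenSegmentIntegral U V (M a) (M b) = ∫ᶜ x in Path.segment (M a) (M b), Ω x :=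
    greenSegmentIntegral_eq_curveIntegral U V _ _
  -- Step 4: homotopy invariance inside the convex set `{Im > ε}`
  obtain ⟨ε, hε, hεγ, hεa, hεb⟩ : ∃ ε : ℝ, 0 < ε ∧ (∀ τ : unitInterval, 2 * ε ≤ (γ₁ τ).im) ∧
      2 * ε ≤ (M a).im ∧ 2 * ε ≤ (M b).im := by
    have hcont : Continuous fun τ : unitInterval => (γ₁ τ).im :=
      Complex.continuous_im.comp γ₁.continuous
    obtain ⟨τ₀, -, hτ₀⟩ := isCompact_univ.exists_isMinOn univ_nonempty hcont.continuousOn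
    have hpos : 0 < (γ₁ τ₀).im := by rw [hγ₁]; exact hMO _ (hℓO _ τ₀.2)
    refine ⟨min (γ₁ τ₀).im (min (M a).im (M b).im) / 2, by
      have := hMO _ a.im_pos; have := hMO _ b.im_pos; positivity, fun τ => ?_, ?_, ?_⟩
    · have hmin : (γ₁ τ₀).im ≤ (γ₁ τ).im := (isMinOn_iff.mp hτ₀) τ (mem_univ τ)
      linarith [min_le_left (γ₁ τ₀).im (min (M a).im (M b).im)]
    · linarith [min_le_right (γ₁ τ₀).im (min (M a).im (M b).im),
        min_le_left (M a).im (M b).im]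
    · linarith [min_le_right (γ₁ τ₀).im (min (M a).im (M b).im),
        min_le_right (M a).im (M b).im]
  set T : Set ℂ := {z : ℂ | ε < z.im} with hT
  have hTO : T ⊆ O := fun z hz => lt_trans hε hz
  have hTconv : Convex ℝ T := convex_halfSpace_im_gt ε
  have hclT : closure T ⊆ O := by
    have : closure T ⊆ {z : ℂ | ε ≤ z.im} :=
      closure_minimal (fun z hz => by simp only [mem_setOf_eq] at hz ⊢; exact hz.le)
        (isClosed_le continuous_const Complex.continuous_im)
    exact fun z hz => lt_of_lt_of_le hε (this hz)
  -- derivative data of `Ω` on `O`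
  have hex : ∀ w ∈ O, ∃ D : ℂ →L[ℝ] ℂ →L[ℝ] ℂ, HasFDerivAt Ω D w ∧ ∀ k l : ℂ, D k l = D l k :=
    fun w hw => hasFDerivAt_greenOneForm_symm hOo hU hV hw (hΔ w hw)
  choose! D hD using hex
  let φ := ContinuousMap.Homotopy.affine (γ₁ : C(unitInterval, ℂ))
    (Path.segment (M a) (M b) : C(unitInterval, ℂ))
  have hφ : ∀ x y : unitInterval, φ (x, y) =
      AffineMap.lineMap (γ₁ y) (AffineMap.lineMap (M a) (M b) (y : ℝ)) (x : ℝ) := fun x y => by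
    simp [φ, Path.segment_apply]
  have hhom := φ.curveIntegral_add_curveIntegral_eq_of_hasFDerivWithinAt (t := T) (ω := Ω)
    (dω := D) ?_ ?_ ?_ ?_ ?_
  · -- conclude from the homotopy identity: the two extra integrals are over constant paths
    have e1 : ∫ᶜ x in φ.evalAt 1, Ω x = 0 := by
      rw [ContinuousMap.Homotopy.evalAt_affine, curveIntegral_segment]
      simp
    have e0 : ∫ᶜ x in φ.evalAt 0, Ω x = 0 := by
      rw [ContinuousMap.Homotopy.evalAt_affine, curveIntegral_segment]
      simp
    rw [e1, e0, add_zero, add_zero] at hhom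
    rw [hstep1, ← hstep2, hhom, ← hMa, ← hMb, hstep3]
  · -- the homotopy stays in `T`
    intro x _ y _
    rw [hφ]
    have h1 : 2 * ε ≤ (γ₁ y).im := hεγ y
    have hy0 : 0 ≤ (y : ℝ) := y.2.1
    have hy1 : (y : ℝ) ≤ 1 := y.2.2
    have h2 : 2 * ε ≤ (1 - (y : ℝ)) * (M a).im + (y : ℝ) * (M b).im := by
      have p1 := mul_nonneg (sub_nonneg.mpr hy1) (sub_nonneg.mpr hεa)
      have p2 := mul_nonneg hy0 (sub_nonneg.mpr hεb)
      nlinarith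
    show ε < _
    simp only [AffineMap.lineMap_apply_module, Complex.add_im, Complex.real_smul,
      Complex.mul_im, Complex.ofReal_re, Complex.ofReal_im, zero_mul, add_zero]
    have hx0 : 0 ≤ (x : ℝ) := x.2.1
    have hx1 : (x : ℝ) ≤ 1 := x.2.2
    have p1 := mul_nonneg (sub_nonneg.mpr hx1) (sub_nonneg.mpr h1)
    have p2 := mul_nonneg hx0 (sub_nonneg.mpr h2)
    nlinarith
  · exact fun w hw => ((hD w (hTO hw)).1).hasFDerivWithinAt
  · exact (continuousOn_greenOneForm hOo hU hV).mono hclT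
  · exact fun w hw k _ l _ => (hD w (hTO hw)).2 k l
  · -- `C²`-smoothness of the affine homotopy between the two smooth paths
    have hEq : EqOn (fun xy : ℝ × ℝ => IccExtend zero_le_one (φ.extend xy.1) xy.2)
        (fun xy => AffineMap.lineMap (M (ℓ xy.2)) (AffineMap.lineMap (M a) (M b) xy.2) xy.1)
        (Icc 0 1) := by
      rw [Icc_prod_eq]
      rintro ⟨x, y⟩ ⟨hx, hy⟩
      lift x to unitInterval using hx
      lift y to unitInterval using hy
      simp [φ, hγ₁, Path.segment_apply]
    refine ContDiffOn.congr ?_ hEq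
    have hsq : MapsTo (fun xy : ℝ × ℝ => ℓ xy.2) (Icc (0 : ℝ × ℝ) 1) O := by
      rw [Icc_prod_eq]
      rintro ⟨x, y⟩ ⟨-, hy⟩
      exact hℓO y hy
    have hℓ2 : ContDiff ℝ 2 (fun xy : ℝ × ℝ => ℓ xy.2) := by simp only [hℓ]; fun_prop
    have hMℓ : ContDiffOn ℝ 2 (fun xy : ℝ × ℝ => M (ℓ xy.2)) (Icc 0 1) :=
      (contDiffOn_smulExtend hg 2).comp hℓ2.contDiffOn hsq
    simp only [AffineMap.lineMap_apply_module]
    apply ContDiffOn.add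
    · exact (contDiff_const.sub contDiff_fst).contDiffOn.smul hMℓ
    · exact (contDiff_fst.smul ((contDiff_const.sub contDiff_snd).smul contDiff_const |>.add
        (contDiff_snd.smul contDiff_const))).contDiffOn

end MoebiusChange

/-! ## 7. The cocycle relation `r_{γδ} = r_γ | δ + r_δ` ((5.4)–(5.5a)) -/

section CocycleLaw

variable {Γ : Subgroup (GL (Fin 2) ℝ)} {s : ℂ} {u : ℍ → ℂ}

/-- The segment integral only sees `U`, `V` on the open upper half-plane (when the endpoints lie
in `ℍ`). [folklore] -/
theorem greenSegmentIntegral_congr_upperHalfPlane {U U' V V' : ℂ → ℂ}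
    (hU : EqOn U U' {z : ℂ | 0 < z.im}) (hV : EqOn V V' {z : ℂ | 0 < z.im}) (a b : ℍ) :
    greenSegmentIntegral U V a b = greenSegmentIntegral U' V' a b := by
  unfold greenSegmentIntegral
  refine intervalIntegral.integral_congr fun τ hτ => ?_
  rw [uIcc_of_le zero_le_one] at hτ
  have hz : 0 < ((1 - (τ : ℂ)) * (a : ℂ) + (τ : ℂ) * (b : ℂ)).im := by
    have ha : 0 < (a : ℂ).im := a.coe_im_pos
    have hb : 0 < (b : ℂ).im := b.coe_im_pos
    simp only [Complex.add_im, Complex.mul_im, Complex.sub_re, Complex.one_re, Complex.ofReal_re,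
      Complex.sub_im, Complex.one_im, Complex.ofReal_im, sub_zero, zero_mul, add_zero]
    rcases eq_or_lt_of_le hτ.1 with h0 | h0
    · rw [← h0]; simpa using ha
    · have : 0 ≤ 1 - τ := by linarith [hτ.2]
      nlinarith [mul_nonneg this ha.le, mul_pos h0 hb]
  have hO : IsOpen {z : ℂ | 0 < z.im} := isOpen_upperHalfPlaneSet
  exact greenForm_congr (hU.eventuallyEq_of_mem (hO.mem_nhds hz))
    (hV.eventuallyEq_of_mem (hO.mem_nhds hz)) _

/-- `∫ [U, c V] = c ∫ [U, V]`. [folklore] -/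
theorem greenSegmentIntegral_const_mul (U V : ℂ → ℂ) (c a b : ℂ) :
    greenSegmentIntegral U (fun z => c * V z) a b = c * greenSegmentIntegral U V a b := by
  unfold greenSegmentIntegral
  rw [← intervalIntegral.integral_const_mul]
  refine intervalIntegral.integral_congr fun τ _ => ?_
  exact greenForm_const_mul U V c _ _

/-- For `u ∈ E_s^Γ` and the Poisson kernel power, `U ΔV = V ΔU` on `ℍ` with `U = u ∘ ofComplex`,
`V = R(t; ·)^s` (both are `λ_s`-eigenfunctions), i.e. `[u, R(t;·)^s]` is closed ((1.10c)).
[cite: BruggemanLewisZagier2015, (1.10c) p. 11] -/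
theorem mul_laplacian_comm_of_eigen (hu : IsInvariantEigenfunction Γ s u) (hs0 : s ≠ 0)
    (hs1 : s ≠ 1) (t : ℝ) (w : ℂ) (hw : 0 < w.im) :
    (u ∘ ofComplex) w * (Δ (hypPoissonKernelCpow s t)) w =
      hypPoissonKernelCpow s t w * (Δ (u ∘ ofComplex)) w := by
  have hV := hypPoissonKernelCpow_eigen hs0 hs1 t hw
  have hU := hu.eigen ⟨w, hw⟩
  simp only [hypLaplacian] at hU
  have hUw : u ⟨w, hw⟩ = (u ∘ ofComplex) w := by
    simp [UpperHalfPlane.ofComplex_apply_of_im_pos hw]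
  replace hU : ((w.im : ℝ) : ℂ) ^ 2 * (Δ (u ∘ ofComplex)) w + s * (1 - s) * (u ∘ ofComplex) w = 0 := by
    rw [← hUw]; exact hU
  have hy : (((w.im : ℝ)) : ℂ) ^ 2 ≠ 0 := by
    have : ((w.im : ℝ) : ℂ) ≠ 0 := by exact_mod_cast hw.ne'
    exact pow_ne_zero 2 this
  apply mul_left_cancel₀ hy
  have e1 : ((w.im : ℝ) : ℂ) ^ 2 * ((u ∘ ofComplex) w * (Δ (hypPoissonKernelCpow s t)) w) =
      (u ∘ ofComplex) w * (-(s * (1 - s) * hypPoissonKernelCpow s t w)) := by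
    linear_combination ((u ∘ ofComplex) w) * hV
  have e2 : ((w.im : ℝ) : ℂ) ^ 2 * (hypPoissonKernelCpow s t w * (Δ (u ∘ ofComplex)) w) =
      hypPoissonKernelCpow s t w * (-(s * (1 - s) * (u ∘ ofComplex) w)) := by
    linear_combination (hypPoissonKernelCpow s t w) * hU
  rw [e1, e2]
  ring

/-- **Equivariance of the period integral** under `δ ∈ Γ` (`Γ ⊂ SL₂(ℝ)`, `u ∈ E_s^Γ`):
`(∫_a^b [u, R(·; ·)^s]) |_{2s} δ = ∫_{δ⁻¹ a}^{δ⁻¹ b} [u, R(·; ·)^s]` at every `t` off the pole of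
`δ` — from `R(·; δ z)^s | δ = R(·; z)^s` ((2.25)), `[u ∘ δ⁻¹, v ∘ δ⁻¹] = [u, v] ∘ δ⁻¹` ((1.10a)),
the `Γ`-invariance of `u`, and path independence. This is the computation behind the cocycle
property of `r` ((5.4), p. 29). [cite: BruggemanLewisZagier2015, (2.25) p. 16 and (5.5a) p. 29] -/
theorem lineSlash_greenPeriod [hΓ : Γ.HasDetOne] (hu : IsInvariantEigenfunction Γ s u)
    (hs0 : s ≠ 0) (hs1 : s ≠ 1) {δ : GL (Fin 2) ℝ} (hδ : δ ∈ Γ) (a b : ℍ) {t : ℝ}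
    (ht : δ 1 0 * t + δ 1 1 ≠ 0) :
    lineSlash s δ (greenPeriod s u a b) t = greenPeriod s u (δ⁻¹ • a) (δ⁻¹ • b) t := by
  have hdet : δ.det = 1 := hΓ.det_eq hδ
  have hpos : 0 < δ.det.val := by simp [hdet]
  have hpos' : 0 < (δ⁻¹).det.val := by simp [hdet]
  set M : ℂ → ℂ := fun w : ℂ => ((δ⁻¹ • ofComplex w : ℍ) : ℂ) with hM
  set C : ℂ := ((|δ 1 0 * t + δ 1 1| : ℝ) : ℂ) ^ (-(2 * s)) with hC
  set t' : ℝ := (δ 0 0 * t + δ 0 1) / (δ 1 0 * t + δ 1 1) with ht'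
  -- `u ∘ δ⁻¹ = u` on `ℍ`
  have hUinv : ((u ∘ ofComplex) ∘ M) = u ∘ ofComplex := by
    funext w
    simp only [Function.comp_apply, hM, UpperHalfPlane.ofComplex_apply]
    exact hu.invariant δ⁻¹ (inv_mem hδ) (ofComplex w)
  -- `R(t; δ⁻¹ z)^s = |ct + d|^{-2s} R(δ t; z)^s` on `ℍ` ((2.25))
  have hVinv : EqOn (hypPoissonKernelCpow s t ∘ M) (fun z => C * hypPoissonKernelCpow s t' z)
      {z : ℂ | 0 < z.im} := by
    intro z hz
    have key := hypPoissonKernelCpow_glSmul s hpos (δ⁻¹ • (⟨z, hz⟩ : ℍ)) ht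
    rw [smul_inv_smul, hdet] at key
    simp only [Units.val_one, Complex.ofReal_one, Complex.one_cpow, one_mul] at key
    simp only [Function.comp_apply, hM, UpperHalfPlane.ofComplex_apply_of_im_pos hz]
    rw [← key]
  -- change of variables along `δ⁻¹`
  have hchg := greenSegmentIntegral_comp_smul (g := δ⁻¹) hpos' hu.isC2
    (contDiffOn_hypPoissonKernelCpow s t) (mul_laplacian_comm_of_eigen hu hs0 hs1 t) a b
  unfold greenPeriod
  rw [← hchg, hUinv, greenSegmentIntegral_congr_upperHalfPlane (fun _ _ => rfl) hVinv a b,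
    greenSegmentIntegral_const_mul, lineSlash_apply]

/-- **The cocycle relation (5.4) for `r` of (5.5a)**: for `Γ ⊂ SL₂(ℝ)`, `u ∈ E_s^Γ`
(`s ≠ 0, 1`), `γ, δ ∈ Γ` and every `t` off the pole of `δ`,
`r_{γδ}(t) = (r_γ | δ)(t) + r_δ(t)`. [cite: BruggemanLewisZagier2015, (5.4)–(5.5a) p. 29] -/
theorem lewisZagierCocycle_mul [Γ.HasDetOne] (hu : IsInvariantEigenfunction Γ s u)
    (hs0 : s ≠ 0) (hs1 : s ≠ 1) {γ δ : GL (Fin 2) ℝ} (hγ : γ ∈ Γ) (hδ : δ ∈ Γ) (z₀ : ℍ)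
    {t : ℝ} (ht : δ 1 0 * t + δ 1 1 ≠ 0) :
    lewisZagierCocycle s z₀ u (γ * δ) t =
      lineSlash s δ (lewisZagierCocycle s z₀ u γ) t + lewisZagierCocycle s z₀ u δ t := by
  have _ := hγ
  have e : lewisZagierCocycle s z₀ u γ = greenPeriod s u (γ⁻¹ • z₀) z₀ := rfl
  simp only [lewisZagierCocycle]
  rw [e, lineSlash_greenPeriod hu hs0 hs1 hδ _ _ ht, mul_inv_rev, mul_smul]
  exact (greenPeriod_add hu hs0 hs1 t _ _ _).symm

/-- The cocycle relation modulo finite sets (the pole of `δ` is at most one point).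
[cite: BruggemanLewisZagier2015, (5.4)–(5.5a) p. 29] -/
theorem lewisZagierCocycle_mul_cofinite [Γ.HasDetOne] (hu : IsInvariantEigenfunction Γ s u)
    (hs0 : s ≠ 0) (hs1 : s ≠ 1) {γ δ : GL (Fin 2) ℝ} (hγ : γ ∈ Γ) (hδ : δ ∈ Γ) (z₀ : ℍ) :
    ∀ᶠ t in cofinite, lewisZagierCocycle s z₀ u (γ * δ) t =
      lineSlash s δ (lewisZagierCocycle s z₀ u γ) t + lewisZagierCocycle s z₀ u δ t := by
  have hfin : {t : ℝ | δ 1 0 * t + δ 1 1 = 0}.Finite := by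
    by_cases hc : (δ 1 0 : ℝ) = 0
    · by_cases hd : (δ 1 1 : ℝ) = 0
      · -- `c = d = 0` contradicts invertibility
        exfalso
        have h1 : ((δ : GL (Fin 2) ℝ) : Matrix (Fin 2) (Fin 2) ℝ).det ≠ 0 :=
          Matrix.GeneralLinearGroup.det_ne_zero δ
        rw [Matrix.det_fin_two] at h1
        apply h1
        rw [hc, hd]; ring
      · have : {t : ℝ | δ 1 0 * t + δ 1 1 = 0} = ∅ := by
          ext t; simp [hc, hd]
        rw [this]; exact finite_empty
    · have : {t : ℝ | δ 1 0 * t + δ 1 1 = 0} ⊆ {-(δ 1 1 : ℝ) / δ 1 0} := by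
        intro t ht
        simp only [mem_setOf_eq] at ht
        simp only [mem_singleton_iff]
        field_simp
        linarith
      exact (finite_singleton _).subset this
  refine (hfin.eventually_cofinite_notMem).mono fun t ht => ?_
  exact lewisZagierCocycle_mul hu hs0 hs1 hγ hδ z₀ ht

end CocycleLaw

/-! ## 8. The complexified Poisson kernel and the ratio kernel of the canonical model

BLZ move `t` off the real line ((1.7), p. 10): `R(ζ; z)^s = y^s/((ζ - z)^s (ζ - z̄)^s)`. We use the
single-valued rational function `R_η(w) = Im w / ((η - w)(η - w̄))` of `(η, w) ∈ ℂ × ℂ`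
(holomorphic in `η`; for real `η = t` it is `R(t; w)`), and, following the *canonical hybrid
model* of Bruggeman–Lewis–Zagier's companion paper (Function theory related to PSL₂(ℝ), §4.2,
Thm 4.2: the representative `B_s u` of the hyperfunction `P_s⁻¹ u`), the **ratio kernel**
`V_η(w) = (R_η(w)/R_η(z₀))^s` with a base point `z₀` (principal branch), which is exactly
invariant under simultaneous Möbius transformation of `η`, `w`, `z₀`. -/

section ComplexKernel

/-- The complexified Poisson kernel `R_η(w) = Im w / ((η - w)(η - w̄))` (BLZ (1.7) before taking
the `s`-th power; for `η = t ∈ ℝ` this is `R(t; w) = y/|t - w|²`).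
[cite: BruggemanLewisZagier2015, (1.7) p. 10] -/
def poissonKernelC (η w : ℂ) : ℂ :=
  (w.im : ℂ) / ((η - w) * (η - conj w))

/-- The **ratio kernel** `V_η(w) = (R_η(w) / R_η(z₀))^s` (principal branch) of the canonical
hybrid model with base point `z₀`: the integrand of the canonical hyperfunction representative
`(B_s u)(η, z₀) = u(z₀) + ∫_{z₀}^{η} [u, (R_η/R_η(z₀))^s]`.
[cite: BruggemanLewisZagier2015, (1.7) p. 10] -/
def ratioKernel (s z₀ η w : ℂ) : ℂ :=
  (poissonKernelC η w / poissonKernelC η z₀) ^ s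

/-- Unfolding. [cite: BruggemanLewisZagier2015, (1.7) p. 10] -/
theorem poissonKernelC_apply (η w : ℂ) :
    poissonKernelC η w = (w.im : ℂ) / ((η - w) * (η - conj w)) :=
  rfl

/-- For real `η = t` the complexified kernel is the Poisson kernel `R(t; w) = y / |w - t|²`.
[cite: BruggemanLewisZagier2015, (1.6)–(1.7) p. 10] -/
theorem poissonKernelC_ofReal (t : ℝ) (w : ℂ) :
    poissonKernelC t w = ((hypPoissonKernel t w : ℝ) : ℂ) := by
  rw [poissonKernelC, hypPoissonKernel, Complex.ofReal_div, Complex.sq_norm, ← Complex.mul_conj,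
    map_sub, Complex.conj_ofReal]
  ring

/-- The ratio kernel is `1` at the base point (when `R_η(z₀) ≠ 0`). [folklore] -/
theorem ratioKernel_self {s z₀ η : ℂ} (h : poissonKernelC η z₀ ≠ 0) : ratioKernel s z₀ η z₀ = 1 := by
  simp [ratioKernel, div_self h]

/-- **Möbius covariance of the complexified kernel** (the holomorphic extension of (2.25)):
for `g = (a b; c d)` with `ad - bc = 1` (real entries), `R_{gη}(g w) = (c η + d)² R_η(w)`
whenever the denominators `cη + d`, `cw + d` are nonzero.
[cite: BruggemanLewisZagier2015, (2.25) p. 16] -/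
theorem poissonKernelC_moebius {a b c d : ℝ} (hdet : a * d - b * c = 1) {η w : ℂ}
    (hη : (c : ℂ) * η + d ≠ 0) (hw : (c : ℂ) * w + d ≠ 0) :
    poissonKernelC (((a : ℂ) * η + b) / ((c : ℂ) * η + d)) (((a : ℂ) * w + b) / ((c : ℂ) * w + d)) =
      ((c : ℂ) * η + d) ^ 2 * poissonKernelC η w := by
  have hwc : (c : ℂ) * conj w + d ≠ 0 := by
    intro h
    apply hw
    have := congrArg conj h
    simpa using this
  have hdetC : (a : ℂ) * d - b * c = 1 := by exact_mod_cast hdet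
  unfold poissonKernelC
  -- imaginary part of the image point
  have him : ((((a : ℂ) * w + b) / ((c : ℂ) * w + d)).im : ℂ) =
      (w.im : ℂ) / (((c : ℂ) * w + d) * ((c : ℂ) * conj w + d)) := by
    have key : (((a : ℂ) * w + b) / ((c : ℂ) * w + d)) -
        conj (((a : ℂ) * w + b) / ((c : ℂ) * w + d)) =
        (w - conj w) / (((c : ℂ) * w + d) * ((c : ℂ) * conj w + d)) := by
      rw [map_div₀]
      simp only [map_add, map_mul, Complex.conj_ofReal]
      rw [div_sub_div _ _ hw hwc]
      congr 1
      linear_combination (w - conj w) * hdetC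
    have e1 : ∀ z : ℂ, ((z.im : ℝ) : ℂ) = (z - conj z) / (2 * Complex.I) := fun z => by
      rw [Complex.sub_conj]
      field_simp
      push_cast
      ring
    rw [e1, key, e1 w]
    field_simp
  -- conjugate of the image point
  have hconj : conj (((a : ℂ) * w + b) / ((c : ℂ) * w + d)) =
      ((a : ℂ) * conj w + b) / ((c : ℂ) * conj w + d) := by
    rw [map_div₀]; simp
  rw [him, hconj]
  rw [div_sub_div _ _ hη hw, div_sub_div _ _ hη hwc]
  have e2 : ((a : ℂ) * η + b) * ((c : ℂ) * w + d) - ((c : ℂ) * η + d) * ((a : ℂ) * w + b) =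
      η - w := by linear_combination (η - w) * hdetC
  have e3 : ((a : ℂ) * η + b) * ((c : ℂ) * conj w + d) -
      ((c : ℂ) * η + d) * ((a : ℂ) * conj w + b) = η - conj w := by
    linear_combination (η - conj w) * hdetC
  rw [e2, e3]
  field_simp

end ComplexKernel

section FactoredEigen

/-- **Factored complex-parameter Poisson kernels are `λ_s`-eigenfunctions.** For `η, c₁, c₂ ∈ ℂ`
the function `w ↦ (Im w)^s (c₁(η - w))^{-s} conj((c₂(η̄ - w))^{-s̄})` (principal powers) satisfies
`y² Δ_w V + s(1-s) V = 0` at every `w` of the upper half-plane where the two bases lie in the slit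
plane (so that the powers are smooth) — locally this is a constant multiple of `R(η; ·)^s`
((1.7): "for `ζ ∈ ℂ` it is an element of `E_s(U)`"). The case `η = t ∈ ℝ`, `c₁ = c₂ = -1` is
`hypPoissonKernelCpow_eigen`. [cite: BruggemanLewisZagier2015, (1.7) p. 10] -/
theorem factoredKernel_eigen {s : ℂ} (hs0 : s ≠ 0) (hs1 : s ≠ 1) (η c₁ c₂ : ℂ) {z : ℂ}
    (hz : 0 < z.im) (h₁ : c₁ * (η - z) ∈ Complex.slitPlane)
    (h₂ : c₂ * (conj η - z) ∈ Complex.slitPlane) :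
    ((z.im : ℝ) : ℂ) ^ 2 * (Δ (fun w : ℂ => ((w.im : ℝ) : ℂ) ^ s *
        ((c₁ * (η - w)) ^ (-s) * conj ((c₂ * (conj η - w)) ^ (-(conj s)))))) z +
      s * (1 - s) * (((z.im : ℝ) : ℂ) ^ s *
        ((c₁ * (η - z)) ^ (-s) * conj ((c₂ * (conj η - z)) ^ (-(conj s))))) = 0 := by
  -- the open set where everything is smooth
  set O : Set ℂ := {w : ℂ | 0 < w.im ∧ c₁ * (η - w) ∈ Complex.slitPlane ∧
    c₂ * (conj η - w) ∈ Complex.slitPlane} with hO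
  have hOo : IsOpen O := by
    refine (isOpen_lt continuous_const Complex.continuous_im).inter
      ((Complex.isOpen_slitPlane.preimage (by fun_prop)).inter
        (Complex.isOpen_slitPlane.preimage ?_))
    exact (continuous_const.mul (continuous_const.sub continuous_id))
  have hzO : z ∈ O := ⟨hz, h₁, h₂⟩
  set P : ℂ → ℂ := fun w => ((w.im : ℝ) : ℂ) ^ s with hP
  set F : ℂ → ℂ := fun w => (c₁ * (η - w)) ^ (-s) with hF
  set Ft : ℂ → ℂ := fun w => (c₂ * (conj η - w)) ^ (-(conj s)) with hFt
  set Gc : ℂ → ℂ := fun w => conj (Ft w) with hGc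
  have hVfun : (fun w : ℂ => ((w.im : ℝ) : ℂ) ^ s *
      ((c₁ * (η - w)) ^ (-s) * conj ((c₂ * (conj η - w)) ^ (-(conj s))))) = P * (F * Gc) := by
    funext w; simp only [Pi.mul_apply, hP, hF, hGc, hFt]
  rw [hVfun]
  change ((z.im : ℝ) : ℂ) ^ 2 * (Δ (P * (F * Gc))) z + s * (1 - s) * (P z * (F z * Gc z)) = 0
  -- nonvanishing of the bases at `z`
  have hc₁ : c₁ ≠ 0 := by
    rintro rfl; simp [Complex.mem_slitPlane_iff] at h₁
  have hc₂ : c₂ ≠ 0 := by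
    rintro rfl; simp [Complex.mem_slitPlane_iff] at h₂
  have haz : η - z ≠ 0 := by
    intro h; rw [h, mul_zero] at h₁; simp [Complex.mem_slitPlane_iff] at h₁
  have hbz : conj η - z ≠ 0 := by
    intro h; rw [h, mul_zero] at h₂; simp [Complex.mem_slitPlane_iff] at h₂
  -- holomorphy of the factors on `O`
  have hFd : DifferentiableOn ℂ F O := by
    intro w hw
    apply DifferentiableAt.differentiableWithinAt
    simp only [hF]
    exact ((differentiableAt_const _).mul ((differentiableAt_const _).sub differentiableAt_id)).cpow_const
      hw.2.1
  have hFtd : DifferentiableOn ℂ Ft O := by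
    intro w hw
    apply DifferentiableAt.differentiableWithinAt
    simp only [hFt]
    exact ((differentiableAt_const _).mul ((differentiableAt_const _).sub differentiableAt_id)).cpow_const
      hw.2.2
  have hP2 : ContDiffAt ℝ 2 P z := (analyticAt_im_cpow s hz).contDiffAt
  have hF2 : ContDiffAt ℝ 2 F z := contDiffAt_real_of_differentiableOn hOo hFd hzO 2
  have hGc2 : ContDiffAt ℝ 2 Gc z := contDiffAt_real_conj_of_differentiableOn hOo hFtd hzO 2
  have hQ2 : ContDiffAt ℝ 2 (F * Gc) z := hF2.mul hGc2
  -- atoms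
  set y : ℂ := ((z.im : ℝ) : ℂ) with hy
  have hy0 : y ≠ 0 := by rw [hy]; exact_mod_cast hz.ne'
  set a : ℂ := η - z with ha
  set b : ℂ := η - conj z with hb
  set Y2 : ℂ := y ^ (s - 2) with hY2
  set Fm : ℂ := c₁ * (c₁ * a) ^ (-s - 1) with hFm
  set Gm : ℂ := conj (c₂ * (c₂ * (conj η - z)) ^ (-(conj s) - 1)) with hGm
  have hc₁a : c₁ * a ≠ 0 := mul_ne_zero hc₁ haz
  have hc₂b : c₂ * (conj η - z) ≠ 0 := mul_ne_zero hc₂ hbz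
  -- values of the factors at `z`
  have hPz : P z = y ^ 2 * Y2 := by
    simp only [hP, hY2, ← hy]
    rw [show s = (s - 2) + 2 from by ring, Complex.cpow_add _ _ hy0, Complex.cpow_two]
    ring_nf
  have hFz : F z = a * Fm := by
    simp only [hF, hFm, ← ha]
    rw [show -s = (-s - 1) + 1 from by ring, Complex.cpow_add _ _ hc₁a, Complex.cpow_one]
    ring_nf
  have hGcz : Gc z = b * Gm := by
    simp only [hGc, hFt, hGm, hb]
    rw [show -(conj s) = (-(conj s) - 1) + 1 from by ring, Complex.cpow_add _ _ hc₂b,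
      Complex.cpow_one, map_mul, map_mul, map_mul, map_sub, Complex.conj_conj]
    ring_nf
  -- derivatives of the factors at `z`
  have hlin : HasDerivAt (fun w : ℂ => c₁ * (η - w)) (-c₁) z := by
    simpa using ((hasDerivAt_id z).const_sub η).const_mul c₁
  have hlin' : HasDerivAt (fun w : ℂ => c₂ * (conj η - w)) (-c₂) z := by
    simpa using ((hasDerivAt_id z).const_sub (conj η)).const_mul c₂
  have hFder : HasDerivAt F (s * Fm) z := by
    have := hlin.cpow_const (c := -s) h₁
    convert this using 1
    simp only [hFm, ha]; ring
  have hFtder : HasDerivAt Ft (conj s * (c₂ * (c₂ * (conj η - z)) ^ (-(conj s) - 1))) z := by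
    have := hlin'.cpow_const (c := -(conj s)) h₂
    convert this using 1
    ring
  have hDF : ∀ v : ℂ, fderiv ℝ F z v = v * (s * Fm) := fun v =>
    fderiv_real_apply_of_hasDerivAt hFder v
  have hDGc : ∀ v : ℂ, fderiv ℝ Gc z v = conj v * (s * Gm) := fun v => by
    rw [show Gc = fun w => conj (Ft w) from rfl, fderiv_real_conj_apply_of_hasDerivAt hFtder v]
    simp only [map_mul, Complex.conj_conj, hGm]
  obtain ⟨hDP1, hDPI, hΔP⟩ := fderiv_laplacian_im_cpow hs0 hs1 hz
  have hys1 : y ^ (s - 1) = y * Y2 := by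
    rw [hY2, show s - 1 = (s - 2) + 1 from by ring, Complex.cpow_add _ _ hy0, Complex.cpow_one]
    ring
  -- Laplacians of the factors
  have hΔF : (Δ F) z = 0 := laplacian_eq_zero_of_differentiableOn hOo hFd hzO
  have hΔGc : (Δ Gc) z = 0 := laplacian_conj_eq_zero_of_differentiableOn hOo hFtd hzO
  have hΔQ := laplacian_mul hF2 hGc2
  have hDQ : ∀ v : ℂ, fderiv ℝ (F * Gc) z v = F z * fderiv ℝ Gc z v + Gc z * fderiv ℝ F z v := by
    intro v
    rw [((hF2.differentiableAt two_ne_zero).hasFDerivAt.mul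
      (hGc2.differentiableAt two_ne_zero).hasFDerivAt).fderiv]
    simp only [add_apply, smul_apply, smul_eq_mul]
  -- assemble
  rw [laplacian_mul hP2 hQ2, hΔQ, hDQ, hDQ]
  simp only [Pi.mul_apply]
  rw [hΔF, hΔGc, hDF, hDF, hDGc, hDGc, hDP1, hDPI, hΔP, hPz, hFz, hGcz, hys1]
  simp only [map_one, Complex.conj_I]
  have hI2 : Complex.I * Complex.I = -1 := Complex.I_mul_I
  have hab : b = a + 2 * y * Complex.I := by
    simp only [ha, hb, hy]
    apply Complex.ext
    · simp
    · simp; ring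
  linear_combination (2 * s ^ 2 * y ^ 3 * Complex.I * Y2 * Fm * Gm) * hab +
    (2 * s ^ 2 * y ^ 4 * Y2 * Fm * Gm) * hI2

end FactoredEigen

section LocalIdentification

/-- A continuous function whose exponential is locally constant is itself locally constant
(logarithms are rigid: nearby values differing by `2πiℤ` are equal). [folklore] -/
theorem eventuallyEq_of_exp_eq {d : ℂ → ℂ} {w₀ : ℂ} (hd : ContinuousAt d w₀)
    (hexp : ∀ᶠ w in 𝓝 w₀, Complex.exp (d w) = Complex.exp (d w₀)) :
    ∀ᶠ w in 𝓝 w₀, d w = d w₀ := by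
  have hnear : ∀ᶠ w in 𝓝 w₀, ‖d w - d w₀‖ < 2 * Real.pi := by
    have := Metric.tendsto_nhds.mp hd (2 * Real.pi) (by positivity)
    filter_upwards [this] with w hw
    rwa [dist_eq_norm] at hw
  filter_upwards [hnear, hexp] with w hw he
  obtain ⟨n, hn⟩ := Complex.exp_eq_exp_iff_exists_int.mp he
  have hsub : d w - d w₀ = n * (2 * Real.pi * Complex.I) := by rw [hn]; ring
  have hnorm : ‖d w - d w₀‖ = |(n : ℝ)| * (2 * Real.pi) := by
    rw [hsub, norm_mul, norm_mul, norm_mul, Complex.norm_I, mul_one, Complex.norm_intCast,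
      Complex.norm_real, Complex.norm_two, Real.norm_eq_abs, abs_of_pos Real.pi_pos]
  rw [hnorm] at hw
  have hn0 : |(n : ℝ)| < 1 := by
    by_contra hcon
    have hcon' : (1 : ℝ) ≤ |(n : ℝ)| := le_of_not_gt hcon
    have : (1 : ℝ) * (2 * Real.pi) ≤ |(n : ℝ)| * (2 * Real.pi) :=
      mul_le_mul_of_nonneg_right hcon' (by positivity)
    linarith
  have hn1 : n = 0 := by
    have h' : |n| < 1 := by exact_mod_cast hn0
    have := abs_lt.mp h'
    omega
  rw [hn1] at hsub
  simpa [sub_eq_zero] using hsub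

variable {s z₀ η : ℂ}

/-- **Local identification of the ratio kernel with a factored kernel.** Near any point `w₀` of
the upper half-plane (`w₀ ≠ η, η̄`, `R_η(z₀) ≠ 0`, and `R_η(w₀)/R_η(z₀)` off the cut) there are a
constant `K` and rotations `c₁ = conj(η - w₀)`, `c₂ = conj(η̄ - w₀)` with
`(R_η/R_η(z₀))^s = K · (Im w)^s (c₁(η - w))^{-s} conj((c₂(η̄ - w))^{-s̄})` for `w` near `w₀`
(two continuous logarithms of the same function differ by a constant).
[cite: BruggemanLewisZagier2015, (1.7) p. 10] -/
theorem ratioKernel_eventuallyEq_factored (s : ℂ) {z₀ η w₀ : ℂ} (hw₀ : 0 < w₀.im)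
    (hηw : η ≠ w₀) (hηw' : conj η ≠ w₀) (hz₀ : poissonKernelC η z₀ ≠ 0)
    (hbase : poissonKernelC η w₀ / poissonKernelC η z₀ ∈ Complex.slitPlane) :
    ∃ K : ℂ, conj (η - w₀) * (η - w₀) ∈ Complex.slitPlane ∧
      conj (conj η - w₀) * (conj η - w₀) ∈ Complex.slitPlane ∧
      ratioKernel s z₀ η =ᶠ[𝓝 w₀] fun w => K * (((w.im : ℝ) : ℂ) ^ s *
        ((conj (η - w₀) * (η - w)) ^ (-s) * conj ((conj (conj η - w₀) * (conj η - w)) ^ (-(conj s))))) := by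
  set c₁ : ℂ := conj (η - w₀) with hc₁
  set c₂ : ℂ := conj (conj η - w₀) with hc₂
  have ha0 : η - w₀ ≠ 0 := sub_ne_zero.mpr hηw
  have hb0 : conj η - w₀ ≠ 0 := sub_ne_zero.mpr hηw'
  have hc₁0 : c₁ ≠ 0 := (map_ne_zero _).mpr ha0
  have hc₂0 : c₂ ≠ 0 := (map_ne_zero _).mpr hb0
  -- at `w₀` the rotated bases are positive reals
  have hpos₁ : c₁ * (η - w₀) ∈ Complex.slitPlane := by
    rw [hc₁, mul_comm, Complex.mul_conj]
    exact Complex.ofReal_mem_slitPlane.mpr (Complex.normSq_pos.mpr ha0)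
  have hpos₂ : c₂ * (conj η - w₀) ∈ Complex.slitPlane := by
    rw [hc₂, mul_comm, Complex.mul_conj]
    exact Complex.ofReal_mem_slitPlane.mpr (Complex.normSq_pos.mpr hb0)
  -- the two exponents
  set base : ℂ → ℂ := fun w => poissonKernelC η w / poissonKernelC η z₀ with hbase_def
  set A : ℂ → ℂ := fun w => Complex.log (base w) with hA
  set B : ℂ → ℂ := fun w => Complex.log ((w.im : ℝ) : ℂ) - Complex.log (c₁ * (η - w)) -
    conj (Complex.log (c₂ * (conj η - w))) with hB
  -- open conditions near `w₀`
  have hcont_base : ContinuousAt base w₀ := by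
    simp only [hbase_def, poissonKernelC]
    have h1 : ContinuousAt (fun w : ℂ => ((w.im : ℝ) : ℂ) / ((η - w) * (η - conj w))) w₀ := by
      refine ContinuousAt.div (by fun_prop) (by fun_prop) ?_
      exact mul_ne_zero ha0 (by
        intro h; apply hb0
        have := congrArg conj h; simpa using this)
    exact h1.div_const _
  have hev_slit : ∀ᶠ w in 𝓝 w₀, base w ∈ Complex.slitPlane :=
    hcont_base.preimage_mem_nhds (Complex.isOpen_slitPlane.mem_nhds hbase)
  have hev₁ : ∀ᶠ w in 𝓝 w₀, c₁ * (η - w) ∈ Complex.slitPlane :=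
    (ContinuousAt.preimage_mem_nhds (by fun_prop) (Complex.isOpen_slitPlane.mem_nhds hpos₁))
  have hev₂ : ∀ᶠ w in 𝓝 w₀, c₂ * (conj η - w) ∈ Complex.slitPlane := by
    have hc : ContinuousAt (fun w : ℂ => c₂ * (conj η - w)) w₀ := by fun_prop
    exact hc.preimage_mem_nhds (Complex.isOpen_slitPlane.mem_nhds hpos₂)
  have hev_im : ∀ᶠ w in 𝓝 w₀, 0 < w.im :=
    (isOpen_lt continuous_const Complex.continuous_im).mem_nhds hw₀
  -- `exp B = κ · exp A` with a constant `κ`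
  set κ : ℂ := poissonKernelC η z₀ / (c₁ * conj c₂) with hκ
  have hκ0 : κ ≠ 0 := div_ne_zero hz₀ (mul_ne_zero hc₁0 ((map_ne_zero _).mpr hc₂0))
  have hexpAB : ∀ᶠ w in 𝓝 w₀, Complex.exp (B w) = κ * Complex.exp (A w) := by
    filter_upwards [hev_slit, hev₁, hev₂, hev_im] with w hs h1 h2 him
    have hbne : base w ≠ 0 := Complex.slitPlane_ne_zero hs
    have h1ne : c₁ * (η - w) ≠ 0 := Complex.slitPlane_ne_zero h1
    have h2ne : c₂ * (conj η - w) ≠ 0 := Complex.slitPlane_ne_zero h2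
    have hyne : ((w.im : ℝ) : ℂ) ≠ 0 := by exact_mod_cast him.ne'
    have haw : η - w ≠ 0 := fun h => h1ne (by rw [h, mul_zero])
    have hbw : conj η - w ≠ 0 := fun h => h2ne (by rw [h, mul_zero])
    have hbw' : η - conj w ≠ 0 := by
      intro h; apply hbw; have := congrArg conj h; simpa using this
    have hcc₂ : conj c₂ ≠ 0 := (map_ne_zero _).mpr hc₂0
    simp only [hA, hB]
    rw [Complex.exp_log hbne, Complex.exp_sub, Complex.exp_sub, Complex.exp_log hyne,
      Complex.exp_log h1ne, Complex.exp_conj, Complex.exp_log h2ne]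
    rw [show base w = poissonKernelC η w / poissonKernelC η z₀ from rfl, hκ, poissonKernelC_apply η w]
    simp only [map_mul, map_sub, Complex.conj_conj]
    field_simp
  -- `B - A` is continuous at `w₀` and has locally constant exponential, hence is locally constant
  have hcontA : ContinuousAt A w₀ :=
    ContinuousAt.comp (g := Complex.log) (f := base) (x := w₀) (continuousAt_clog hbase) hcont_base
  have hcontB : ContinuousAt B w₀ := by
    simp only [hB]
    refine ContinuousAt.sub (ContinuousAt.sub ?_ ?_) ?_
    · exact ContinuousAt.comp (g := Complex.log) (f := fun w : ℂ => ((w.im : ℝ) : ℂ)) (x := w₀)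
        (continuousAt_clog (Complex.ofReal_mem_slitPlane.mpr hw₀)) (by fun_prop)
    · exact ContinuousAt.comp (g := Complex.log) (f := fun w : ℂ => c₁ * (η - w)) (x := w₀)
        (continuousAt_clog hpos₁) (by fun_prop)
    · have hin : ContinuousAt (fun w : ℂ => Complex.log (c₂ * (conj η - w))) w₀ :=
        ContinuousAt.comp (g := Complex.log) (f := fun w : ℂ => c₂ * (conj η - w)) (x := w₀)
          (continuousAt_clog hpos₂) (by fun_prop)
      exact ContinuousAt.comp (g := fun q : ℂ => conj q)
        (f := fun w : ℂ => Complex.log (c₂ * (conj η - w))) (x := w₀)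
        Complex.continuous_conj.continuousAt hin
  have hd : ∀ᶠ w in 𝓝 w₀, (B w - A w) = (B w₀ - A w₀) := by
    apply eventuallyEq_of_exp_eq (hcontB.sub hcontA)
    filter_upwards [hexpAB] with w hw
    have hw₀' : Complex.exp (B w₀) = κ * Complex.exp (A w₀) := hexpAB.self_of_nhds
    show Complex.exp (B w - A w) = Complex.exp (B w₀ - A w₀)
    rw [Complex.exp_sub (B w) (A w), Complex.exp_sub (B w₀) (A w₀), hw, hw₀']
    have hA0 : Complex.exp (A w) ≠ 0 := Complex.exp_ne_zero _
    have hA0' : Complex.exp (A w₀) ≠ 0 := Complex.exp_ne_zero _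
    field_simp
  -- conclude
  refine ⟨Complex.exp (-(s * (B w₀ - A w₀))), hpos₁, hpos₂, ?_⟩
  filter_upwards [hd, hev_slit, hev₁, hev₂, hev_im] with w hdw hs h1 h2 him
  have hbne : base w ≠ 0 := Complex.slitPlane_ne_zero hs
  have h1ne : c₁ * (η - w) ≠ 0 := Complex.slitPlane_ne_zero h1
  have h2ne : c₂ * (conj η - w) ≠ 0 := Complex.slitPlane_ne_zero h2
  have hyne : ((w.im : ℝ) : ℂ) ≠ 0 := by exact_mod_cast him.ne'
  -- both sides as exponentials
  have lhs : ratioKernel s z₀ η w = Complex.exp (s * A w) := by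
    simp only [ratioKernel, hA, hbase_def]
    rw [Complex.cpow_def_of_ne_zero hbne, mul_comm]
  have rhs : ((w.im : ℝ) : ℂ) ^ s * ((c₁ * (η - w)) ^ (-s) *
      conj ((c₂ * (conj η - w)) ^ (-(conj s)))) = Complex.exp (s * B w) := by
    simp only [hB]
    rw [Complex.cpow_def_of_ne_zero hyne, Complex.cpow_def_of_ne_zero h1ne,
      Complex.cpow_def_of_ne_zero h2ne, ← Complex.exp_conj, ← Complex.exp_add, ← Complex.exp_add]
    congr 1
    simp only [map_mul, map_neg, Complex.conj_conj]
    ring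
  rw [lhs, rhs, ← Complex.exp_add]
  congr 1
  simp only [hA, hB] at hdw ⊢
  linear_combination (-s) * hdw

/-- **The ratio kernel is a `λ_s`-eigenfunction** in the second variable:
`y² Δ_w (R_η/R_η(z₀))^s + s(1-s) (R_η/R_η(z₀))^s = 0` at every `w` of the upper half-plane with
`w ≠ η, η̄` and `R_η(w)/R_η(z₀)` off the cut `(-∞, 0]` (`s ≠ 0, 1`).
[cite: BruggemanLewisZagier2015, (1.7) p. 10] -/
theorem ratioKernel_eigen (hs0 : s ≠ 0) (hs1 : s ≠ 1) {w₀ : ℂ} (hw₀ : 0 < w₀.im)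
    (hηw : η ≠ w₀) (hηw' : conj η ≠ w₀) (hz₀ : poissonKernelC η z₀ ≠ 0)
    (hbase : poissonKernelC η w₀ / poissonKernelC η z₀ ∈ Complex.slitPlane) :
    ((w₀.im : ℝ) : ℂ) ^ 2 * (Δ (ratioKernel s z₀ η)) w₀ + s * (1 - s) * ratioKernel s z₀ η w₀ = 0 := by
  obtain ⟨K, h₁, h₂, hev⟩ := ratioKernel_eventuallyEq_factored s hw₀ hηw hηw' hz₀ hbase
  set Vf : ℂ → ℂ := fun w => ((w.im : ℝ) : ℂ) ^ s *
    ((conj (η - w₀) * (η - w)) ^ (-s) * conj ((conj (conj η - w₀) * (conj η - w)) ^ (-(conj s))))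
    with hVf
  have hev' : ratioKernel s z₀ η =ᶠ[𝓝 w₀] K • Vf := by
    filter_upwards [hev] with w hw; simpa [hVf, smul_eq_mul] using hw
  have hVfeig := factoredKernel_eigen hs0 hs1 η (conj (η - w₀)) (conj (conj η - w₀)) hw₀ h₁ h₂
  -- regularity of `Vf` at `w₀` (needed for `Δ (K • Vf) = K • Δ Vf`)
  have hVf2 : ContDiffAt ℝ 2 Vf w₀ := by
    have hO : IsOpen {w : ℂ | conj (η - w₀) * (η - w) ∈ Complex.slitPlane} :=
      Complex.isOpen_slitPlane.preimage (by fun_prop)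
    have hO' : IsOpen {w : ℂ | conj (conj η - w₀) * (conj η - w) ∈ Complex.slitPlane} :=
      Complex.isOpen_slitPlane.preimage (continuous_const.mul (continuous_const.sub continuous_id))
    have hF : ContDiffAt ℝ 2 (fun w : ℂ => (conj (η - w₀) * (η - w)) ^ (-s)) w₀ :=
      contDiffAt_real_of_differentiableOn hO (fun w hw =>
        (((differentiableAt_const _).mul ((differentiableAt_const _).sub
          differentiableAt_id)).cpow_const hw).differentiableWithinAt) h₁ 2
    have hG : ContDiffAt ℝ 2
        (fun w : ℂ => conj ((conj (conj η - w₀) * (conj η - w)) ^ (-(conj s)))) w₀ :=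
      contDiffAt_real_conj_of_differentiableOn hO' (fun w hw =>
        (((differentiableAt_const _).mul ((differentiableAt_const _).sub
          differentiableAt_id)).cpow_const hw).differentiableWithinAt) h₂ 2
    exact (analyticAt_im_cpow s hw₀).contDiffAt.mul (hF.mul hG)
  rw [(InnerProductSpace.laplacian_congr_nhds hev').eq_of_nhds,
    InnerProductSpace.laplacian_smul K hVf2, hev'.self_of_nhds]
  simp only [Pi.smul_apply, smul_eq_mul]
  have := hVfeig
  simp only [hVf] at this ⊢
  linear_combination K * this

/-- The ratio kernel is `C²` (indeed real-analytic) at such points. [folklore] -/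
theorem contDiffAt_ratioKernel (s : ℂ) {w₀ : ℂ}
    (hηw : η ≠ w₀) (hηw' : conj η ≠ w₀) (hz₀ : poissonKernelC η z₀ ≠ 0)
    (hbase : poissonKernelC η w₀ / poissonKernelC η z₀ ∈ Complex.slitPlane) (n : WithTop ℕ∞) :
    ContDiffAt ℝ n (ratioKernel s z₀ η) w₀ := by
  -- `w ↦ R_η(w)/R_η(z₀)` is real-analytic at `w₀`, and `q ↦ q^s` is analytic on the slit plane
  have ha0 : η - w₀ ≠ 0 := sub_ne_zero.mpr hηw
  have hb0 : η - conj w₀ ≠ 0 := by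
    rw [sub_ne_zero]; intro h; apply hηw'; rw [h]; simp
  have h1 : AnalyticAt ℝ (fun w : ℂ => poissonKernelC η w / poissonKernelC η z₀) w₀ := by
    simp only [poissonKernelC]
    have him : AnalyticAt ℝ (fun w : ℂ => ((w.im : ℝ) : ℂ)) w₀ :=
      (Complex.ofRealCLM.analyticAt _).comp (Complex.imCLM.analyticAt w₀)
    have hconj : AnalyticAt ℝ (fun w : ℂ => conj w) w₀ := Complex.conjCLE.analyticAt w₀
    have hden : AnalyticAt ℝ (fun w : ℂ => (η - w) * (η - conj w)) w₀ :=
      (analyticAt_const.sub analyticAt_id).mul (analyticAt_const.sub hconj)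
    exact (him.div hden (mul_ne_zero ha0 hb0)).div analyticAt_const hz₀
  have h2 : AnalyticAt ℂ (fun q : ℂ => q ^ s) (poissonKernelC η w₀ / poissonKernelC η z₀) :=
    AnalyticAt.cpow analyticAt_id analyticAt_const hbase
  have h3 : AnalyticAt ℝ ((fun q : ℂ => q ^ s) ∘ fun w : ℂ => poissonKernelC η w / poissonKernelC η z₀)
      w₀ :=
    AnalyticAt.comp (g := fun q : ℂ => q ^ s) (f := fun w : ℂ => poissonKernelC η w / poissonKernelC η z₀)
      (x := w₀) (h2.restrictScalars (𝕜 := ℝ)) h1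
  have hcomp : ratioKernel s z₀ η =
      ((fun q : ℂ => q ^ s) ∘ fun w : ℂ => poissonKernelC η w / poissonKernelC η z₀) := rfl
  rw [hcomp]
  exact h3.contDiffAt (n := n)

end LocalIdentification

section RatioKernelBasics

variable {s z₀ η : ℂ}

/-- **Möbius invariance of the ratio kernel**: for `g ∈ SL₂(ℝ)`,
`(R_{gη}(g w)/R_{gη}(g z₀))^s = (R_η(w)/R_η(z₀))^s` off the poles — the two-variable
normalisation absorbs the automorphy factor of (2.25) exactly (no branch ambiguity).
[cite: BruggemanLewisZagier2015, (2.25) p. 16] -/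
theorem ratioKernel_moebius {a b c d : ℝ} (hdet : a * d - b * c = 1) {z₀ η w : ℂ}
    (hη : (c : ℂ) * η + d ≠ 0) (hw : (c : ℂ) * w + d ≠ 0) (hz₀ : (c : ℂ) * z₀ + d ≠ 0) (s : ℂ) :
    ratioKernel s (((a : ℂ) * z₀ + b) / ((c : ℂ) * z₀ + d)) (((a : ℂ) * η + b) / ((c : ℂ) * η + d))
        (((a : ℂ) * w + b) / ((c : ℂ) * w + d)) = ratioKernel s z₀ η w := by
  unfold ratioKernel
  rw [poissonKernelC_moebius hdet hη hw, poissonKernelC_moebius hdet hη hz₀,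
    mul_div_mul_left _ _ (pow_ne_zero 2 hη)]

/-- The point `(1 - τ) z₀ + τ η` of the segment from `z₀` to `η`. [folklore] -/
theorem segment_sub_eq (z₀ η : ℂ) (τ : ℝ) :
    η - ((1 - (τ : ℂ)) * z₀ + (τ : ℂ) * η) = (1 - (τ : ℂ)) * (η - z₀) := by ring

/-- **Geometry of the ratio base along the segment** `z' = (1-τ) z₀ + τ η` from the base point
`z₀ ∈ ℍ` towards `η ∈ ℍ`: `(η - z̄')/(η - z̄₀) = (1 - τ) + 2iτ Im η/(η - z̄₀)` has positive real
part for `τ ∈ [0, 1]`. [folklore] -/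
theorem re_segment_ratio_pos {z₀ η : ℂ} (hz₀ : 0 < z₀.im) (hη : 0 < η.im) {τ : ℝ}
    (hτ : τ ∈ Icc (0 : ℝ) 1) :
    0 < ((η - conj ((1 - (τ : ℂ)) * z₀ + (τ : ℂ) * η)) / (η - conj z₀)).re := by
  set q : ℂ := η - conj z₀ with hq
  have hqim : 0 < q.im := by simp [hq]; linarith
  have hq0 : q ≠ 0 := fun h => by rw [h] at hqim; simp at hqim
  have hnum : η - conj ((1 - (τ : ℂ)) * z₀ + (τ : ℂ) * η) =
      (1 - (τ : ℂ)) * q + (τ : ℂ) * (η - conj η) := by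
    simp only [hq, map_add, map_mul, map_sub, map_one, Complex.conj_ofReal]
    ring
  rw [hnum]
  have e : ((1 - (τ : ℂ)) * q + (τ : ℂ) * (η - conj η)) / q = (1 - (τ : ℂ)) + (τ : ℂ) * ((η - conj η) / q) := by
    field_simp
  rw [e, Complex.add_re]
  have h1 : ((1 - (τ : ℂ)) : ℂ).re = 1 - τ := by simp
  have h2 : ((τ : ℂ) * ((η - conj η) / q)).re = τ * (2 * η.im * q.im / Complex.normSq q) := by
    rw [Complex.re_ofReal_mul, Complex.sub_conj, Complex.div_re]
    simp
  rw [h1, h2]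
  have hnsq : 0 < Complex.normSq q := Complex.normSq_pos.mpr hq0
  have ht0 : 0 ≤ τ := hτ.1
  have ht1 : τ ≤ 1 := hτ.2
  have hpos : 0 < 2 * η.im * q.im / Complex.normSq q := by positivity
  rcases eq_or_lt_of_le ht1 with h | h
  · rw [h]; linarith
  · nlinarith [mul_nonneg ht0 hpos.le]

/-- The ratio base along the segment: for `τ ∈ [0, 1)`,
`R_η(z')/R_η(z₀) = (1 - τ)⁻¹ · W` with `W = (Im z'/ Im z₀) · (η - z̄₀)/(η - z̄')`, `Re W > 0`;
in particular the base lies in the slit plane, and the principal branch of its `s`-th power is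
continuous along the segment and equals `1` at `z₀` (the branch of the companion paper's
Thm 4.2). [cite: BruggemanLewisZagier2015, (1.7) p. 10] -/
theorem ratioBase_segment {z₀ η : ℂ} (hz₀ : 0 < z₀.im) (hη : 0 < η.im) (hne : η ≠ z₀) {τ : ℝ}
    (hτ : τ ∈ Ico (0 : ℝ) 1) :
    ∃ W : ℂ, 0 < W.re ∧
      W = ((((1 - (τ : ℂ)) * z₀ + (τ : ℂ) * η).im / z₀.im : ℝ) : ℂ) *
        ((η - conj z₀) / (η - conj ((1 - (τ : ℂ)) * z₀ + (τ : ℂ) * η))) ∧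
      poissonKernelC η ((1 - (τ : ℂ)) * z₀ + (τ : ℂ) * η) / poissonKernelC η z₀ =
        (((1 - τ)⁻¹ : ℝ) : ℂ) * W := by
  set z' : ℂ := (1 - (τ : ℂ)) * z₀ + (τ : ℂ) * η with hz'
  have hτ1 : 0 < 1 - τ := by linarith [hτ.2]
  have hy' : 0 < z'.im := by
    simp only [hz', Complex.add_im, Complex.mul_im, Complex.sub_re, Complex.one_re,
      Complex.ofReal_re, Complex.sub_im, Complex.one_im, Complex.ofReal_im, sub_zero, zero_mul,
      add_zero]
    nlinarith [mul_pos hτ1 hz₀, mul_nonneg hτ.1 hη.le]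
  have hq0 : η - conj z₀ ≠ 0 := by
    intro h
    have := congrArg Complex.im h
    simp at this; linarith
  have hq'0 : η - conj z' ≠ 0 := by
    intro h
    have := congrArg Complex.im h
    simp at this; linarith
  have ha0 : η - z₀ ≠ 0 := sub_ne_zero.mpr hne
  have ha'0 : η - z' ≠ 0 := by
    rw [hz', segment_sub_eq]
    exact mul_ne_zero (by exact_mod_cast hτ1.ne') ha0
  have hy0 : ((z₀.im : ℝ) : ℂ) ≠ 0 := by exact_mod_cast hz₀.ne'
  have hratio := re_segment_ratio_pos hz₀ hη (Ico_subset_Icc_self hτ)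
  rw [← hz'] at hratio
  refine ⟨((z'.im / z₀.im : ℝ) : ℂ) * ((η - conj z₀) / (η - conj z')), ?_, rfl, ?_⟩
  · -- `Re W > 0`: positive real times a number whose inverse has positive real part
    rw [Complex.re_ofReal_mul]
    apply mul_pos (div_pos hy' hz₀)
    have hinv : (η - conj z₀) / (η - conj z') = ((η - conj z') / (η - conj z₀))⁻¹ := by
      rw [inv_div]
    rw [hinv, Complex.inv_re]
    apply div_pos hratio
    exact Complex.normSq_pos.mpr (div_ne_zero hq'0 hq0)
  · simp only [poissonKernelC]
    rw [show η - z' = (1 - (τ : ℂ)) * (η - z₀) from by rw [hz', segment_sub_eq]]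
    have h1τ : ((1 - τ : ℝ) : ℂ) ≠ 0 := by exact_mod_cast hτ1.ne'
    push_cast
    field_simp

/-- Along the segment from `z₀` to `η` (both in `ℍ`, `τ ∈ [0,1)`) the ratio base is in the slit
plane and the point is neither `η` nor `η̄`. [folklore] -/
theorem ratioBase_segment_mem_slitPlane {z₀ η : ℂ} (hz₀ : 0 < z₀.im) (hη : 0 < η.im)
    (hne : η ≠ z₀) {τ : ℝ} (hτ : τ ∈ Ico (0 : ℝ) 1) :
    poissonKernelC η ((1 - (τ : ℂ)) * z₀ + (τ : ℂ) * η) / poissonKernelC η z₀ ∈ Complex.slitPlane ∧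
    η ≠ (1 - (τ : ℂ)) * z₀ + (τ : ℂ) * η ∧ conj η ≠ (1 - (τ : ℂ)) * z₀ + (τ : ℂ) * η ∧
    0 < ((1 - (τ : ℂ)) * z₀ + (τ : ℂ) * η).im := by
  obtain ⟨W, hre, -, heq⟩ := ratioBase_segment hz₀ hη hne hτ
  have hτ1 : 0 < 1 - τ := by linarith [hτ.2]
  have hy' : 0 < ((1 - (τ : ℂ)) * z₀ + (τ : ℂ) * η).im := by
    simp only [Complex.add_im, Complex.mul_im, Complex.sub_re, Complex.one_re,
      Complex.ofReal_re, Complex.sub_im, Complex.one_im, Complex.ofReal_im, sub_zero, zero_mul,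
      add_zero]
    nlinarith [mul_pos hτ1 hz₀, mul_nonneg hτ.1 hη.le]
  refine ⟨?_, ?_, ?_, hy'⟩
  · rw [heq, Complex.mem_slitPlane_iff]
    left
    rw [Complex.re_ofReal_mul]
    exact mul_pos (inv_pos.mpr hτ1) hre
  · intro h
    have : η - ((1 - (τ : ℂ)) * z₀ + (τ : ℂ) * η) = 0 := sub_eq_zero.mpr h
    rw [segment_sub_eq] at this
    rcases mul_eq_zero.mp this with h1 | h1
    · have : (1 : ℂ) - τ ≠ 0 := by exact_mod_cast hτ1.ne'
      exact this h1
    · exact hne (sub_eq_zero.mp h1)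
  · intro h
    have := congrArg Complex.im h
    simp at this
    nlinarith [mul_pos hτ1 hz₀, mul_nonneg hτ.1 hη.le, hη]

/-- `R_η(z₀) ≠ 0` for `η` in the upper half-plane and `z₀ ∈ ℍ`, `η ≠ z₀`. [folklore] -/
theorem poissonKernelC_ne_zero {η w : ℂ} (hw : 0 < w.im) (hηw : η ≠ w) (hηw' : η ≠ conj w) :
    poissonKernelC η w ≠ 0 := by
  unfold poissonKernelC
  refine div_ne_zero (by exact_mod_cast hw.ne') (mul_ne_zero (sub_ne_zero.mpr hηw)
    (sub_ne_zero.mpr hηw'))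

/-- For `u ∈ E_s^Γ` and the ratio kernel, `U ΔV = V ΔU` at good points (both are
`λ_s`-eigenfunctions): the Green's form `[u, (R_η/R_η(z₀))^s]` is closed there ((1.10c)).
[cite: BruggemanLewisZagier2015, (1.10c) p. 11] -/
theorem mul_laplacian_comm_ratioKernel {Γ : Subgroup (GL (Fin 2) ℝ)} {u : ℍ → ℂ}
    (hu : IsInvariantEigenfunction Γ s u) (hs0 : s ≠ 0) (hs1 : s ≠ 1) {w : ℂ} (hw : 0 < w.im)
    (hηw : η ≠ w) (hηw' : conj η ≠ w) (hz₀ : poissonKernelC η z₀ ≠ 0)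
    (hbase : poissonKernelC η w / poissonKernelC η z₀ ∈ Complex.slitPlane) :
    (u ∘ ofComplex) w * (Δ (ratioKernel s z₀ η)) w =
      ratioKernel s z₀ η w * (Δ (u ∘ ofComplex)) w := by
  have hV := ratioKernel_eigen hs0 hs1 hw hηw hηw' hz₀ hbase
  have hU := hu.eigen ⟨w, hw⟩
  simp only [hypLaplacian] at hU
  have hUw : u ⟨w, hw⟩ = (u ∘ ofComplex) w := by
    simp [UpperHalfPlane.ofComplex_apply_of_im_pos hw]
  replace hU : ((w.im : ℝ) : ℂ) ^ 2 * (Δ (u ∘ ofComplex)) w + s * (1 - s) * (u ∘ ofComplex) w = 0 := by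
    rw [← hUw]; exact hU
  have hy : (((w.im : ℝ)) : ℂ) ^ 2 ≠ 0 := by
    have : ((w.im : ℝ) : ℂ) ≠ 0 := by exact_mod_cast hw.ne'
    exact pow_ne_zero 2 this
  apply mul_left_cancel₀ hy
  have e1 : ((w.im : ℝ) : ℂ) ^ 2 * ((u ∘ ofComplex) w * (Δ (ratioKernel s z₀ η)) w) =
      (u ∘ ofComplex) w * (-(s * (1 - s) * ratioKernel s z₀ η w)) := by
    linear_combination ((u ∘ ofComplex) w) * hV
  have e2 : ((w.im : ℝ) : ℂ) ^ 2 * (ratioKernel s z₀ η w * (Δ (u ∘ ofComplex)) w) =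
      ratioKernel s z₀ η w * (-(s * (1 - s) * (u ∘ ofComplex) w)) := by
    linear_combination (ratioKernel s z₀ η w) * hU
  rw [e1, e2]
  ring

/-- **Path additivity of `∫ [u, (R_η/R_η(z₀))^s]` over triangles** in a convex open subset of
`ℍ` on which the ratio base stays in the slit plane and which avoids `η`, `η̄` (closedness of the
Green's form for two `λ_s`-eigenfunctions, (1.10c)). [cite: BruggemanLewisZagier2015, (1.10c) p. 11] -/
theorem greenSegmentIntegral_ratioKernel_triangle {Γ : Subgroup (GL (Fin 2) ℝ)} {u : ℍ → ℂ}
    (hu : IsInvariantEigenfunction Γ s u) (hs0 : s ≠ 0) (hs1 : s ≠ 1) {O : Set ℂ}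
    (hO : IsOpen O) (hOc : Convex ℝ O)
    (hOgood : ∀ w ∈ O, 0 < w.im ∧ η ≠ w ∧ conj η ≠ w ∧
      poissonKernelC η w / poissonKernelC η z₀ ∈ Complex.slitPlane)
    (hz₀ : poissonKernelC η z₀ ≠ 0) {a b c : ℂ} (ha : a ∈ O) (hb : b ∈ O) (hc : c ∈ O) :
    greenSegmentIntegral (u ∘ ofComplex) (ratioKernel s z₀ η) a b +
        greenSegmentIntegral (u ∘ ofComplex) (ratioKernel s z₀ η) b c =
      greenSegmentIntegral (u ∘ ofComplex) (ratioKernel s z₀ η) a c := by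
  have hOH : O ⊆ {z : ℂ | 0 < z.im} := fun w hw => (hOgood w hw).1
  have hU : ContDiffOn ℝ 2 (u ∘ ofComplex) O := hu.isC2.mono hOH
  have hV : ContDiffOn ℝ 2 (ratioKernel s z₀ η) O := fun w hw =>
    (contDiffAt_ratioKernel s (hOgood w hw).2.1 (hOgood w hw).2.2.1 hz₀
      (hOgood w hw).2.2.2 2).contDiffWithinAt
  exact greenSegmentIntegral_triangle hO hOc hU hV
    (fun w hw => mul_laplacian_comm_ratioKernel hu hs0 hs1 (hOgood w hw).1 (hOgood w hw).2.1
      (hOgood w hw).2.2.1 hz₀ (hOgood w hw).2.2.2) ha hb hc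

end RatioKernelBasics

end Literature.NumberTheory.Automorphic
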